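import Summits.BirchSwinnertonDyer.BirchSwinnertonDyer.Theses.ErratumRoadFive
import Summits.BirchSwinnertonDyer.BirchSwinnertonDyer.Theorems.ErratumRoadFiveJSWAnticyclotomicControlMultOfItems
import Summits.BirchSwinnertonDyer.BirchSwinnertonDyer.Theorems.ErratumRoadFiveKolyvaginRestTam
import Summits.BirchSwinnertonDyer.BirchSwinnertonDyer.Theorems.ErratumRoadFiveRamNoErratumDataKolyvaginTam
import Summits.BirchSwinnertonDyer.BirchSwinnertonDyer.Theorems.ErratumRoadFiveOpenInputRung5835a1
import Summits.BirchSwinnertonDyer.BirchSwinnertonDyer.Theorems.ErratumRoadFiveRest3SlackRungs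
import Summits.BirchSwinnertonDyer.BirchSwinnertonDyer.Theorems.ErratumRoadFiveRest3ShaBranchesByName
import Summits.BirchSwinnertonDyer.BirchSwinnertonDyer.Theorems.ErratumRoadFiveRest3DWitnessD1Visible
import Summits.BirchSwinnertonDyer.BirchSwinnertonDyer.Theorems.ErratumRoadFiveRest3DWitnessD2Visible
import Literature.NumberTheory.EllipticCurves.Fisher2012.HesseFamilyFiveCongruence

/-!
# BC3 birth skeleton v17 (seat rest-p2 g9, 2026-08-28) = v16 + LINE 3, the TAMAGAWA-REFINED KOLYVAGIN ROAD registered as stubs (statements of v16 byte-identical).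
# The crux has TWO conjecture-grade exits in the tree, both assembled to the route decl BY NAME; v7 registered the first (line 2, the cyclotomic LEVER:
# F + SCH = Schneider's non-degeneracy ON (D)); v17 registers the second: KF `stub_rest3_kolyFacts` = the CITABLE bundle of the Kolyvagin road (Shimura
# reciprocity at conductor 1 `heegnerPointOfConductor_one_galoisConj`, McCallum 1991 Cor. 5.6 `McCallum1991_pow_dvd_card_sha_primary_of_certificate`,
# Darmon Thm. 3.6 `phi_heegnerTau_mem_range_map_singularModuliField` — named Literature facts, not K2 binders) and KZT `stub_rest3_kolyvaginTamFrames` =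
# W. Zhang's TAMAGAWA-REFINED non-vanishing at the Hoffstein–Luo frames of the REST‴ pairs: a Kolyvagin certificate `Koly.CertificateAt Dt β ι p M` of level
# `M + 1` with `M ≤ t := ord_p ∏ c_ℓ(E)` (VERBATIM the binder `hZt` of `Theorems.ramNoErratumDataAtFive_of_publishedInputsFive_of_kolyvaginTamFramesHL`, seat
# rest-p2 g2 on ACCEL seat nw1's `openInputOnTree_onRam_of_kolyvaginTamFramesHL_of_thm331Mult`, p462313; TIGHT: ⟺ STEP L modulo McCallum, nw1
# `Theorems/ErratumRoadFiveRest3NoWitnessOffLocusKolyvaginTamTight.lean`). On the Locus (`t = 0`) KZT is Kolyvagin's conjecture mod `p` = [SkinnerZhang2014] Thm. 1.3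
# (UNREFEREED); at a Tamagawa-`p` pair it is the shape of [BurungaleCastellaGrossiSkinner2026] Thm. 2 (`M_∞ = Σ ord_p c_ℓ`), in print for GOOD ORDINARY `p` only —
# GENUINE, class-wide OPEN at `p ∥ N`. Composition `RamNoErratumDataAtFive_of_kolyvaginTam_items (hPub) (hRed) (hKF) (hZt)` = g2's theorem with the JSW control
# derived from 19283 (p596606). Registered OPEN stubs after v17: SD (line 1; ≡ crux mod PUB), SCH (line 2), KZT (line 3); F, KF citable. CENSUS WORDS refreshed
# (DEEPCENSUS v5 §7, this seat): REST⁗@5 15 174 ∕ 15 174 pairs carry a numerically verified certificate row meeting a LANDED kernel row checker's criteria.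
# BC3 birth skeleton v16 (seat rest-p2 g8, 2026-08-28) = v15 with the census words of the genuine stub SCH refreshed (its docstring said «kernel-certified at four of
# the seven (D)-members»; now: the bundled predicate is a kernel theorem modulo GZK at ALL 17 SD members of record — D0–D6, TR1–TR10 — and numerically
# non-degenerate at all 15 174 REST⁗@5 pairs; generic depth-`K` first-order checker `KernelCertFive.certNonsplit_of_certDepth` p601854). Statements byte-identical.
# v15 (seat rest-p2 g8, 2026-08-28) = v14 UNCHANGED + the compositions RE-KEYED to the route's `closes` binders after plan g39's «DROP-JSW» (K2 rev 42,
# 19626 `JSWAnticyclotomicControlMult` → aside): `RamNoErratumDataAtFive_of_items` ∕ `_proof_items` ∕ `_of_regulator_items` ∕ `_proof_regulator_items` take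
# `(hPub : PublishedInputsFive) (hRed : PublishedInputsIMCReduction)` — items 19066 ∕ 19283, both binders of `closes` rev 42 — and DERIVE the JSW control input by
# imc-p1 g16's `Theorems.jswAnticyclotomicControlMult_of_publishedInputsIMCReduction` (p596606: 19626 ⟸ 19283 by name, via the two Poitou–Tate facts). The v4
# compositions with the binder `hJSW` stay (nothing referenced is removed); stub statements unchanged (they keep `h331` as a hypothesis, fed the derived term).
# v14 (seat rest-p2 g8, 2026-08-28) = v13 + R21 `stub_rung_shaDiv_TR7_lever`, R22 `stub_rung_shaDiv_TR8_lever` (TR7 = 1770b1 ⊗ 2557, `v₅(Δ) = 1`; TR8 = 3510j1 ⊗ 857,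
# `v₅(Δ) = 2 = v_L` — the two members OUT of the first exact split checker's regime, now certified by tam3-p2's REGIME-FREE split checker p596892 ∕ p597600, rows
# `…ExactPRowsTRCert.lean`; rungs `Theorems/ErratumRoadFiveRest3TRLeverRungsSplitD{,ByName}.lean`, this seat): **ALL TEN TR members of record and all seven (D) members
# carry a lever rung from PUBLISHED facts alone** (R6–R22). Registered OPEN stubs unchanged: SD (line 1), SCH (line 2); F citable.
# v13 (seat rest-p2 g8, 2026-08-28) = v12 + R20 `stub_rung_shaDiv_TR9_lever` (TR9 = 2480g1 ⊗ 2861, SPLIT at 5, `Q = 60·g` level one, 17 653-digit numeral;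
# cert `certSplit_TR9` p594737 (tam3-p2), rung `Theorems/ErratumRoadFiveRest3TRLeverRungsSplitC.lean` p596834 + by-name file): 9 ∕ 10 TR members of record now carry a lever rung
# from PUBLISHED facts alone; TR7 (ν = 1) ∕ TR8 (ν = 2 = v_L) are out of the exact split checker's regime `k + v_L ≤ ν` (tam3-p2's part 10 is the first half of the fix).
# v12 (seat rest-p2 g8, 2026-08-28) = v10 + FIVE lever rungs at the DEEP members of TR = SD ∩ REST⁗ whose regulator certificates are
# seat tam3-p2 g5's EXACT row checkers («the height is the logarithm of the numerator», `Theorems/KolyvaginRoadThreeSchneiderTamAtThreeHeightLogNumeratorExactP*.lean`):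
# R15 `stub_rung_shaDiv_TR5_lever` (TR5 = 3290b1 ⊗ 2029, NON-split `I₂` at 5, `Q = 6·g` at level two; cert `certNonsplit_TR5` p592576; closer p594115 ∕ p594882),
# R16–R19 `stub_rung_shaDiv_TR{3,4,6,10}_lever` (the SPLIT members 430b1 ⊗ 6729, 1120g1 ⊗ (−2371), 3445b1 ⊗ (−1591), 3435c1 ⊗ (−2123): `c₅ = 5 = v₅(Δ)`, the carrier is
# `5` itself; certs `certSplit_TR{3,4,6,10}` p593873 by the EXACT SPLIT ROW CHECKER p593452 — `ĥ^{split}` against a rational at precision `5^{4k}`, regime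
# `k + v_L ≤ ν`, `v_L ≤ 2k`; at a split (ram) prime ONE split certificate gives `BSD(E,5)` on the lever, `RegMult.bsdp_of_ram_split_of_five_le_of_cert`; closers
# `Theorems/ErratumRoadFiveRest3TRLeverRungsSplit{A,B,ByName}.lean`, this seat). **TR6 is the first member of record of the (T) branch 19702 with `5 ∣ #Ш_an`.**
# TR census in kernel after v12: 9 ∕ 10 members carry a lever rung from PUBLISHED facts alone (TR1 TR2 TR5 non-split; TR3 TR4 TR6 TR10 split; TR9 cert
# → R20 in v13); TR7 (ν = 1), TR8 (ν = 2) are out of the split checker's regime. This seat's independent 5-adic engine (kit j296772, the tree's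
# σ-function definitions evaluated at THE Tate parameter) reproduces every certified valuation. Registered OPEN stubs unchanged: SD (line 1), SCH (line 2); F citable.
# v10 (seat rest-p2 g7, 2026-08-27) = v9 + R13 `stub_rung_shaDiv_TR1_lever`, R14 `stub_rung_shaDiv_TR2_lever`: the FIRST explicit members of
# TR = SD ∩ REST⁗ (`25 ∣ #Ш_an` AND `5 ∣ ∏c` — neither the Ш_an-unit road nor the Tamagawa-free Kolyvagin road applies; kit j289832 ∕ j290888), lever rungs
# from PUBLISHED facts alone with the regulator certificate at depth two, precision four (`Theorems/ErratumRoadFiveRegCertKernelFiveCheckerN4.lean`).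
# v9 = v8 + R11 `stub_rung_shaDiv_D3_lever`, R12 `stub_rung_shaDiv_D0_lever` (the two SPLIT
# (D)-members: BOTH halves of the regulator predicate by the generic SPLIT checker; with R6–R12 ALL SEVEN (D)-members of record carry a lever rung
# from PUBLISHED facts alone). v8 = v7 + R10 `stub_rung_shaDiv_D5_lever` (the fifth (D)-member D5 = 635b1 ⊗ (−3208),
# SECOND-order REG5CERT: `v₅(h(6g)) = 2`; closer `Theorems.Rest3Rungs.stub_rung_shaDiv_D5_lever`). v7 (seat rest-p2 g7) = v6 UNCHANGED + a SECOND, ALTERNATIVE composition of the crux along the cyclotomic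
# LEVER (the `p ≥ 5` twin of the (T) skeleton's `Rest3TorsionBranchAtFive_of_regulator`, rest-p2 g0): every REST‴ pair is a (ram) pair at
# `p ≥ 5`, hence on `ClassClosure.LeverLocusAt`, where `BSD(E,p)` ⟸ PUBLISHED facts (Skinner 2016 Thm. A, Stein–Wuthrich 2013 Thm. 6.1 ∕ §4.2,
# Disegni 2020 Thm. 1, parametrisation; citable bundle F `stub_rest3_leverFacts`) + `ClassClosure.RegulatorNonvanishingAt E p` (Schneider AT
# THE PAIR); so SD ⟸ hPub + hJSW + F + SCH, SCH = `stub_shaDiv_regulatorNonvanishing` = Schneider's non-degeneracy ON THE PAIRS OF (D) ONLY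
# (GENUINE, class-wide OPEN — the programme's reason for K2 is precisely to avoid it; per pair a FINITE `5`-adic computation). New plan-only
# rungs R6–R9 `stub_rung_shaDiv_D{1,2,4,6}_lever` INSIDE (D): the crux's instance at four of the seven (D)-members of record from hPub + hJSW + F
# and NOTHING ELSE — the regulator input is a KERNEL certificate (REG5CERT, seat g7's generic `p = 5` checker
# `Theorems/ErratumRoadFiveRegCertKernelFive{DepthOne,Checker}.lean` + `Theorems/ErratumRoadFiveRest3DLever{CertKernel,Rungs,RungsByName}.lean`):
# no `r_an`, `#Ш_an`, congruence, Cassels–Tate, Tate-uniformisation or Fisher binder (contrast R3–R5). Closed BY NAME by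
# `Theorems.Rest3Rungs.stub_rung_shaDiv_D{1,2,4,6}_lever`. Registered OPEN stubs after v7: SD (line 1), SCH (line 2, Schneider|(D)); F citable.
#
# BC3 birth skeleton v6 (seat rest-p2 g6, 2026-08-27) = v5 with R3 `stub_rung_shaDiv_D1_visible` RESHAPED: the instance binder
# `[V1.IsElliptic]` is DROPPED from its signature (it is a kernel theorem, `Theorems.isElliptic_V1`, p538812) — the v4 signature coincided with the
# landed `Theorems.rung_D1_of_items_of_visibleSha` (p540958), and the gate's dedup lint refuses any by-name restatement of a landed theorem, so R3
# as registered in v4 could never receive a landed mark; the reshaped R3 is strictly stronger and is closed by name by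
# `Theorems.Rest3Rungs.stub_rung_shaDiv_D1_visible` (seat g6 by-name file).
# v5 (seat rest-p2 g6, 2026-08-27): v4 (12ff98fafa2d30d6, registered by planner g34) UNCHANGED + two plan-only rungs R4 ∕ R5
# INSIDE branch (D) whose ONLY data binders are `r_an = 1` and `#Ш_an = 25`: `stub_rung_shaDiv_D1_hesse` and `stub_rung_shaDiv_D2_hesse` — the open
# input at D1 = 235a1 ⊗ (−2167) resp. D2 = 635b1 ⊗ (−2872) from the route's support items `PublishedInputsFive` + `JSWAnticyclotomicControlMult`,
# the published Cassels–Tate pairing and Tate uniformisation, Fisher's published Hesse-family theorem (`Fisher2012.thm132_fiveCongruent_hessePencil`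
# for D1: direct family, V1 = 7755i1 ⊗ (−2167) is the fibre (41173:1); `Fisher2012.thm58_fiveCongruent_hessePencilInd` for D2: indirect family,
# V2 = 72390y1 ⊗ (−2872) is the fibre (−84724:5)) and the two analytic data; the partner's rank (2 ∕ 3), the bad places, all local kinds and the
# paid place being KERNEL theorems (`Theorems/ErratumRoadFiveRest3DWitness{D1VisibleKernel,D2RankKernel,D1HesseKernel,D2VisibleKernel}.lean`,
# p547615 ∕ p549719 ∕ p551017 ∕ p551371). Closed BY NAME by `Theorems.Rest3Rungs.stub_rung_shaDiv_D1_hesse ∕ _D2_hesse` (seat g6 by-name file).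
# Composition unchanged (`rest3_of_shaBranches`); the registered OPEN stubs become {SD, R3, R4, R5} with R3–R5 closed by name on landing.
#
# BC3 birth skeleton v4 (seat rest-p2 g5, 2026-08-27 — RULING 16 A1 + the first (D)-rung): v3's Ш_an CUT (planner g32, registered
# b55a0362d100a083) with (A1) `RamNoErratumDataAtFive_of` taking the route's support binders `(hPub : PublishedInputsFive)
# (hJSW : JSWAnticyclotomicControlMult)` (K2 `closes` binders 19066 ∕ 19626, by name — as 19109's `_of` takes `PublishedInputsThree`)
# and SU `stub_rest3_shaUnit` DERIVED from them (`rest3ShaUnitBranchAtFive_of_publishedInputsFive`, p517130; no sorry), so the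
# registered OPEN stubs are exactly {SD `stub_rest3_shaDiv`, R1, R2, R3}; and (g5) the NEW plan-only rung R3
# `stub_rung_shaDiv_D1_visible` = the first BC5 rung INSIDE the residual branch (D): the open input at the (D)-witness
# D1 = 235a1 ⊗ (−2167) (`#Ш_an = 25`) from the support items + Cassels–Tate + Tate uniformisation + the VISIBLE-Ш certificate
# (5-congruent rank-3 partner V1 = 7755i1 ⊗ (−2167); HOME/rest/VISIBLE-SHA-D.md), closed BY NAME by
# `Theorems.rung_D1_of_items_of_visibleSha` (seat g5). Composition unchanged (`rest3_of_shaBranches`). Crux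
# `ErratumRoadFive.RamNoErratumDataAtFive` (item stmt-BirchSwinnertonDyer-19624, REST‴). DELIVERED to HOME/rest/Lines-birth-19624-v4.lean
# for the planner to register (the seat's unit does not name the crux item).

Route `route-BirchSwinnertonDyer-ErratumRoadFive` (rung K2, closes `X11b.MultiplicativeRankOne`), cell `bsd-stepL`. Registered form:
named stubs `stub_*` (sorries ONLY there), stub statements by name (`Statement.stub_*` via `type_of%`), the composition
`RamNoErratumDataAtFive_of` concluding the ROUTE DECL by name from the stub statements (sorry-free, pure logic), and
`RamNoErratumDataAtFive_proof`.

WHY THE Ш_an CUT (seat g4, Theorems/ErratumRoadFiveRest3{ShaAnCertificate,Exact,ShaBranchesDefs,ShaBranchesByName}.lean): modulo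
`PublishedInputsFive` + `JSWAnticyclotomicControlMult` the crux is EXACTLY the lower half `ord_p #Ш(E)_an ≤ ord_p #Ш(E)` on its pairs
(`ramNoErratumDataAtFive_iff_missingLowerBound_onRest3`), free wherever `ord_p #Ш(E)_an ≤ 0`; so REST‴ ⟺ SD modulo the two support items
(`ramNoErratumDataAtFive_iff_rest3ShaDivisibleBranch`). v2's cut was by `p ∣ ∏c_ℓ` with S1 (Locus) closed only modulo SZ14 Thm 1.3
(PREPRINT) and S2 (REST⁗) not at all; v3's SU is closed modulo PUBLISHED facts and SD ⊂ S1 ∪ S2 is the genuine residual. Census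
(HOME/rest/SHA-CENSUS-REST3.md, two engines): all 703 204 REST‴ pairs `N < 5·10⁵` lie in SU; SD has no instance in Cremona's range
(K2-wide the only X11b pair with `p ∣ #Ш_an` is the ¬(ram) pair (403280bd1, 5)); kit j274486 searches beyond.

* `stub_rest3_shaUnit` — SU: REST‴ at the pairs with `#Ш(E)_an = s ∈ ℚ`, `ord_p s ≤ 0`. v4: DERIVED from the support binders
  `hPub`, `hJSW` (p517130) — no sorry, not an open stub.
* `stub_rest3_shaDiv` — SD: REST‴ at the pairs where every rational value of `#Ш(E)_an` has positive `p`-adic valuation (granted BSD: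
  `Ш(E)[p] ≠ 0`). OPEN; no road in print (erratum road needs a non-split ramified witness; SZ14 Thm 1.3 is PRE, Locus-only and proves the
  `Ш`-trivial case `M_∞ = 0`; BCS 2024/25, BCGS 2023/26, Sweeting 2022 have `p ∤ N`).
* `stub_rung_rest3_5015b1`, `stub_rung_rest4_5595f1` — UNCHANGED from v2 (landed by name p477401; both pairs have `#Ш_an = 1`, so they are
  SU-rungs; the lighter closers `rung_5015b1_of_shaAn_eq_one` / `rung_5595f1_of_shaAn_eq_one` (p514039) need `#Ш_an = 1` alone).
* `stub_rung_shaDiv_D1_visible` — R3 (v4, NEW): the first rung INSIDE SD, at the (D)-witness D1 = 235a1 ⊗ (−2167) = ⟨1,0,0,−23577276,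
  −23098167619⟩ (`N = 1 103 533 915`, `#Ш(D1)_an = 25`, kernel dossier p534559): the open input from `PublishedInputsFive` +
  `JSWAnticyclotomicControlMult` + Cassels–Tate + Tate uniformisation (ATAEC V.5.3/5.4) + the VISIBLE-Ш certificate — a `Γ_ℚ`-isomorphism
  `V1[5] ⥲ D1[5]` from the 5-congruent partner V1 = 7755i1 ⊗ (−2167) = ⟨1,1,1,−17985352701,1881572323801248⟩ of rank 3 (stabilised Sturm at
  level 7755, bound 2305, 0 failures; three explicit points) and the free local kinds at `S = {3,5,11,47,197}` (kit j280476 ∕ j280611 ∕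
  j280667; HOME/rest/VISIBLE-SHA-D.md) — by the tree's kernel Selmer comparison (`exists_sha_ne_zero_of_congr_of_le_off`) read at
  analytic rank ONE (`VisibleLowerHalf.missingLowerBoundAt_of_congr_of_rank_two_of_analyticRank_one_of_irr`, p537417): `Ш(D1)[5] ≠ 0`,
  hence `25 ∣ #Ш(D1)`, hence `Typed.MissingLowerBoundAt D1 5`, hence `P2OpenInputOnTreeAt D1 5` (p538812). Closed BY NAME by
  `Theorems.rung_D1_of_items_of_visibleSha`. SD is NOT closed by it (one pair); D2 = 635b1 ⊗ (−2872) has a certificate of the same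
  kind (partner 72390y1 ⊗ (−2872), one paid place); D0, D3–D6 have none yet.

* `stub_rung_shaDiv_D1_hesse`, `stub_rung_shaDiv_D2_hesse` — R4 ∕ R5 (v5, NEW): the rungs at D1 and at D2 = 635b1 ⊗ (−2872) with the partner's
  rank, places, kinds, paid place AND the 5-congruence (modulo Fisher 2012 Thm. 13.2 ∕ Fisher 2013 Thm. 5.8, named published facts) in the kernel;
  data binders `r_an = 1`, `#Ш_an = 25` only. Closed BY NAME by `Theorems.Rest3Rungs.stub_rung_shaDiv_D{1,2}_hesse`.

[cite: Castella2018Erratum, Thm. 1.1 (iii)–(iv), (2.4)] [cite: JetchevSkinnerWan2017, Thm. 3.3.1, §7.4] [cite: Miller2011LMS, Def. 1.1]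
[cite: SkinnerZhang2014, Thms. 1.1–1.3 (arXiv:1407.1099 §1)] [cite: Kolyvagin1990, Thm. A] [cite: Cremona1997, Table 1 (curves 5015b1, 5595f1, 235a1, 7755i1)]
[cite: CremonaMazur2000, §3] [cite: AgasheStein2002, Thm. 3.1] [cite: SilvermanATAEC1994, V.5.3–5.4]
-/

noncomputable section

open scoped Classical

-- v4: the R3 signature is written with the same `open`s as its by-name closer `Theorems/ErratumRoadFiveRest3DWitnessD1VisibleByName.lean`
open WeierstrassCurve IsDedekindDomain NumberField
  Literature.NumberTheory.EllipticCurves Literature.NumberTheory.EllipticCurves.Rank1Residual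
  Literature.NumberTheory.EllipticCurves.Rank1Residual.Typed
  Summit.BirchSwinnertonDyer.Rank1Residual Summit.BirchSwinnertonDyer.Rank1Residual.X11b

namespace Summit.BirchSwinnertonDyer.BirchSwinnertonDyer.Cruxes.RamNoErratumDataAtFive.Birth

/-! ## Registered stubs -/

/-- **SU · `stub_rest3_shaUnit` — REST‴ AT THE PAIRS CARRYING THE Ш_an DATUM** (`#Ш(E)_an = s ∈ ℚ`, `ord_p s ≤ 0`): the branch
constant `Rest3ShaUnitBranchAtFive` of `Theorems/ErratumRoadFiveRest3ShaBranchesDefs.lean` BY NAME. Closed modulo the route's support items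
`PublishedInputsFive` + `JSWAnticyclotomicControlMult` by `Theorems.rest3ShaUnitBranchAtFive_of_publishedInputsFive` (p517130) — v4:
DERIVED from the two support binders (RULING 16 A1), no sorry, NOT an open stub. All 703 204 REST‴ pairs `N < 5·10⁵` lie in this branch. [cite: JetchevSkinnerWan2017, Thm. 3.3.1] [cite: Miller2011LMS, Def. 1.1] -/
theorem stub_rest3_shaUnit
    (hPub : Summit.BirchSwinnertonDyer.BirchSwinnertonDyer.Theses.ErratumRoadFive.PublishedInputsFive)
    (hJSW : Summit.BirchSwinnertonDyer.BirchSwinnertonDyer.Theses.ErratumRoadFive.JSWAnticyclotomicControlMult) :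
    Summit.BirchSwinnertonDyer.BirchSwinnertonDyer.Theorems.Rest3ShaUnitBranchAtFive :=
  Summit.BirchSwinnertonDyer.BirchSwinnertonDyer.Theorems.rest3ShaUnitBranchAtFive_of_publishedInputsFive hPub hJSW

/-- **SD · `stub_rest3_shaDiv` — THE RESIDUAL: REST‴ AT THE PAIRS WITH `p ∣ #Ш(E)_an`** (every rational value of `#Ш(E)_an` has
positive `p`-adic valuation; granted BSD: `Ш(E)[p] ≠ 0`): the branch constant `Rest3ShaDivisibleBranchAtFive` BY NAME. Modulo the two
support items it is EQUIVALENT to the crux (`Theorems.ramNoErratumDataAtFive_iff_rest3ShaDivisibleBranch`). EMPTY below `5·10⁵`; no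
printed or announced theorem reaches it. [cite: Castella2018Erratum, Thm. 1.1 (iii)–(iv)] [cite: JetchevSkinnerWan2017, §7.4] -/
theorem stub_rest3_shaDiv : Summit.BirchSwinnertonDyer.BirchSwinnertonDyer.Theorems.Rest3ShaDivisibleBranchAtFive := by
  sorry

/-- **R1 · `stub_rung_rest3_5015b1` — PLAN-ONLY BC5 RUNG (piece S1), v2: BY-NAME CERTIFICATE SHAPE.** The open input at
the single pair `(5015b1, 5)` (`N = 5015 = 5·17·59 ≥ 5000`, non-split at 5, `17, 59` split and `E[5]`-ramified, `∏ c_ℓ = 2`,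
`ρ̄₅` onto, `r_an = 1`) from the route's published support items `PublishedInputsFive` + `JSWAnticyclotomicControlMult` and ONE
attested Heegner datum over `ℚ(√−179)` (`β = 141`, `y_K = −2·(9,0)`, `E(K)_tors = 1`; seat g0 kit j255090): the classical
index certificate `5 ∤ [E(K):ℤy_K]` read on the Tamagawa-slack road. Closed by name by
`Theorems.rung_5015b1_d179_of_items_of_slackCert` (p475571). [cite: Cremona1997, Table 1 (5015b1)] [cite: Kolyvagin1990, Thm. A]
[cite: Gross1991, (1.1), (2.2)] [cite: JetchevSkinnerWan2017, Thm. 3.3.1] -/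
theorem stub_rung_rest3_5015b1
    [((⟨0, 0, 1, -248, 1503⟩ : WeierstrassCurve ℤ).baseChange ℚ).IsElliptic] [((⟨0, 0, 1, -248, 1503⟩ : WeierstrassCurve ℤ).baseChange ℚ).IsGloballyMinimal] [NeZero (((⟨0, 0, 1, -248, 1503⟩ : WeierstrassCurve ℤ).baseChange ℚ).conductorNorm ℤ)]
    (hF : Summit.BirchSwinnertonDyer.BirchSwinnertonDyer.Theses.ErratumRoadFive.PublishedInputsFive)
    (h331 : Summit.BirchSwinnertonDyer.BirchSwinnertonDyer.Theses.ErratumRoadFive.JSWAnticyclotomicControlMult)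
    (K : Type) [Field K] [NumberField K] (hK : Literature.NumberTheory.EllipticCurves.IsImaginaryQuadratic K)
    (hdK : NumberField.discr K = -179)
    (hH : Literature.NumberTheory.EllipticCurves.SatisfiesHeegnerHypothesis (((⟨0, 0, 1, -248, 1503⟩ : WeierstrassCurve ℤ).baseChange ℚ).conductorNorm ℤ) K)
    (Dt : Literature.NumberTheory.EllipticCurves.ModularForms.ModularParametrizationData ((⟨0, 0, 1, -248, 1503⟩ : WeierstrassCurve ℤ).baseChange ℚ) (((⟨0, 0, 1, -248, 1503⟩ : WeierstrassCurve ℤ).baseChange ℚ).conductorNorm ℤ))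
    (H : Literature.NumberTheory.EllipticCurves.HeegnerDatum (((⟨0, 0, 1, -248, 1503⟩ : WeierstrassCurve ℤ).baseChange ℚ).conductorNorm ℤ) (NumberField.discr K))
    (ι : K →+* ℂ) (P : (((⟨0, 0, 1, -248, 1503⟩ : WeierstrassCurve ℤ).baseChange ℚ).baseChange K).toAffine.Point)
    (hP : WeierstrassCurve.Affine.Point.map ι.toRatAlgHom P =
      Literature.NumberTheory.EllipticCurves.ModularForms.heegnerPointComplex Dt H)
    (hc : ¬ (5 : ℤ) ∣ Dt.c) (hnt : ¬ IsOfFinAddOrder P)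
    (hidx : padicValNat 5 (AddSubgroup.zmultiples P).index = 0) :
    Summit.BirchSwinnertonDyer.Rank1Residual.X11b.P2OpenInputOnTreeAt
      ((⟨0, 0, 1, -248, 1503⟩ : WeierstrassCurve ℤ).baseChange ℚ) 5 := by
  sorry

/-- **R2 · `stub_rung_rest4_5595f1` — PLAN-ONLY RUNG INSIDE REST⁗ (piece S2), v2: BY-NAME CERTIFICATE SHAPE.** The open
input at the single pair `(5595f1, 5)` (`N = 5595 = 3·5·373 ≥ 5000`, non-split at 5, `c₃ = 5` so `ord₅ ∏ c_ℓ = 1`, `373`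
the (ram) witness, `ρ̄₅` onto, `r_an = 1`) from `PublishedInputsFive` + `JSWAnticyclotomicControlMult` and ONE attested
Tamagawa-SLACK Heegner datum over `ℚ(√−59)` (`β = 259`, `y_K = 5·(−5,4)`, `E(K)_tors = 1`, `ord₅ [E(K):ℤy_K] = 1 ≤ 1`;
seat g0 kit j255090, seat g2 kit j261919) — NO `p`-adic regulator, NO preprint. Closed by name by
`Theorems.rung_5595f1_d59_of_items_of_slackCert` (p475167). [cite: Cremona1997, Table 1 (5595f1)] [cite: Kolyvagin1990, Thm. A]
[cite: Gross1991, (1.1), (2.2)] [cite: JetchevSkinnerWan2017, Thm. 3.3.1, §7.4.1] -/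
theorem stub_rung_rest4_5595f1
    [((⟨1, 0, 0, -71, -234⟩ : WeierstrassCurve ℤ).baseChange ℚ).IsElliptic] [((⟨1, 0, 0, -71, -234⟩ : WeierstrassCurve ℤ).baseChange ℚ).IsGloballyMinimal] [NeZero (((⟨1, 0, 0, -71, -234⟩ : WeierstrassCurve ℤ).baseChange ℚ).conductorNorm ℤ)]
    (hF : Summit.BirchSwinnertonDyer.BirchSwinnertonDyer.Theses.ErratumRoadFive.PublishedInputsFive)
    (h331 : Summit.BirchSwinnertonDyer.BirchSwinnertonDyer.Theses.ErratumRoadFive.JSWAnticyclotomicControlMult)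
    (K : Type) [Field K] [NumberField K] (hK : Literature.NumberTheory.EllipticCurves.IsImaginaryQuadratic K)
    (hdK : NumberField.discr K = -59)
    (hH : Literature.NumberTheory.EllipticCurves.SatisfiesHeegnerHypothesis (((⟨1, 0, 0, -71, -234⟩ : WeierstrassCurve ℤ).baseChange ℚ).conductorNorm ℤ) K)
    (Dt : Literature.NumberTheory.EllipticCurves.ModularForms.ModularParametrizationData ((⟨1, 0, 0, -71, -234⟩ : WeierstrassCurve ℤ).baseChange ℚ) (((⟨1, 0, 0, -71, -234⟩ : WeierstrassCurve ℤ).baseChange ℚ).conductorNorm ℤ))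
    (H : Literature.NumberTheory.EllipticCurves.HeegnerDatum (((⟨1, 0, 0, -71, -234⟩ : WeierstrassCurve ℤ).baseChange ℚ).conductorNorm ℤ) (NumberField.discr K))
    (ι : K →+* ℂ) (P : (((⟨1, 0, 0, -71, -234⟩ : WeierstrassCurve ℤ).baseChange ℚ).baseChange K).toAffine.Point)
    (hP : WeierstrassCurve.Affine.Point.map ι.toRatAlgHom P =
      Literature.NumberTheory.EllipticCurves.ModularForms.heegnerPointComplex Dt H)
    (hc : ¬ (5 : ℤ) ∣ Dt.c) (hnt : ¬ IsOfFinAddOrder P)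
    (hidx : padicValNat 5 (AddSubgroup.zmultiples P).index ≤ 1) :
    Summit.BirchSwinnertonDyer.Rank1Residual.X11b.P2OpenInputOnTreeAt
      ((⟨1, 0, 0, -71, -234⟩ : WeierstrassCurve ℤ).baseChange ℚ) 5 := by
  sorry

/-- **R3 · `stub_rung_shaDiv_D1_visible` — PLAN-ONLY BC5 RUNG INSIDE THE RESIDUAL BRANCH (D), v4; v6: the binder `[V1.IsElliptic]` dropped
(kernel theorem `isElliptic_V1`). BY-NAME CERTIFICATE SHAPE.**
The open input at the single (D)-witness pair `(D1, 5)`, D1 = `235a1 ⊗ (−2167)` = `⟨1, 0, 0, −23577276, −23098167619⟩`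
(`N = 1 103 533 915 = 5·11²·47·197²`, non-split at 5, `47` the split (ram) witness, `11, 197` additive, `ρ̄₅` onto, `r_an = 1`,
`#Ш(D1)_an = 25` — so NO Ш_an-unit datum and no erratum datum: a genuine member of SD) from the route's support items
`PublishedInputsFive` + `JSWAnticyclotomicControlMult`, the published Cassels–Tate pairing (`hCT`) and Tate uniformisation
(`hU`, `hU2`), and the attested VISIBLE-Ш data: `r_an(D1) = 1`, `#Ш(D1)_an = 25`, a `Γ_ℚ`-isomorphism `θ : V1[5] ⥲ D1[5]` from the
5-congruent partner V1 = `7755i1 ⊗ (−2167)` = `⟨1, 1, 1, −17985352701, 1881572323801248⟩` (stabilised-Sturm-certified), `rank V1(ℚ) ≥ 2`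
(three explicit points; PARI rank 3), and the free local kinds at the bad places `S` (certified `S = {3,5,11,47,197}`). Closed by name by
`Theorems.rung_D1_of_items_of_visibleSha` (seat g5). [cite: CremonaMazur2000, §3 and Table 1] [cite: AgasheStein2002, Thm. 3.1 and §3.5]
[cite: SilvermanAEC2009, Thm. X.4.14] [cite: SilvermanATAEC1994, Ch. V Thm. 5.3, Cor. 5.4] [cite: JetchevSkinnerWan2017, Thm. 3.3.1, §7.4.1]
[cite: Cremona1997, Table 1 (235a1, 7755i1)] -/
theorem stub_rung_shaDiv_D1_visible
    [((⟨1, 0, 0, -23577276, -23098167619⟩ : WeierstrassCurve ℤ).baseChange ℚ).IsElliptic]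
    [((⟨1, 0, 0, -23577276, -23098167619⟩ : WeierstrassCurve ℤ).baseChange ℚ).IsGloballyMinimal]
    (hF : Summit.BirchSwinnertonDyer.BirchSwinnertonDyer.Theses.ErratumRoadFive.PublishedInputsFive)
    (h331 : Summit.BirchSwinnertonDyer.BirchSwinnertonDyer.Theses.ErratumRoadFive.JSWAnticyclotomicControlMult)
    (hCT : exists_casselsTate_pairing (K := ℚ))
    (hU : Silverman1994_thmV53_tateUniformisation.{0})
    (hU2 : Silverman1994_thmV53_corV54_tateUniformisation.{0})
    (hr : ((⟨1, 0, 0, -23577276, -23098167619⟩ : WeierstrassCurve ℤ).baseChange ℚ).analyticRank = 1)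
    (hsha : shaAn ((⟨1, 0, 0, -23577276, -23098167619⟩ : WeierstrassCurve ℤ).baseChange ℚ) = ((25 : ℚ) : ℂ))
    (θ : geomTorsion ((⟨1, 1, 1, -17985352701, 1881572323801248⟩ : WeierstrassCurve ℤ).baseChange ℚ) ((5 : ℕ) : ℤ) ≃+
      geomTorsion ((⟨1, 0, 0, -23577276, -23098167619⟩ : WeierstrassCurve ℤ).baseChange ℚ) ((5 : ℕ) : ℤ))
    (hθ : ∀ (σ : Field.absoluteGaloisGroup ℚ) (P : geomTorsion
      ((⟨1, 1, 1, -17985352701, 1881572323801248⟩ : WeierstrassCurve ℤ).baseChange ℚ) ((5 : ℕ) : ℤ)), θ (σ • P) = σ • θ P)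
    (hrank : 2 ≤ ((⟨1, 1, 1, -17985352701, 1881572323801248⟩ : WeierstrassCurve ℤ).baseChange ℚ).mordellWeilRank)
    (S : Finset (HeightOneSpectrum (𝓞 ℚ)))
    (hS : ∀ v : HeightOneSpectrum (𝓞 ℚ), v ∉ S →
      ((⟨1, 0, 0, -23577276, -23098167619⟩ : WeierstrassCurve ℤ).baseChange ℚ).HasGoodReductionAt v ∧
      ((⟨1, 1, 1, -17985352701, 1881572323801248⟩ : WeierstrassCurve ℤ).baseChange ℚ).HasGoodReductionAt v ∧
      ((5 : ℕ) : 𝓞 ℚ) ∉ v.asIdeal)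
    (hplaces : ∀ v ∈ S,
      (((5 : ℕ) : 𝓞 ℚ) ∉ v.asIdeal ∧ Nat.card (nsmulAddMonoidHom 5 :
          ((((⟨1, 1, 1, -17985352701, 1881572323801248⟩ : WeierstrassCurve ℤ).baseChange ℚ)).baseChange
            (v.adicCompletion ℚ)).toAffine.Point →+ _).ker = 1) ∨
      (((⟨1, 0, 0, -23577276, -23098167619⟩ : WeierstrassCurve ℤ).baseChange ℚ).HasSplitMultiplicativeReductionAt v ∧
        ((⟨1, 1, 1, -17985352701, 1881572323801248⟩ : WeierstrassCurve ℤ).baseChange ℚ).HasSplitMultiplicativeReductionAt v ∧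
        Nat.card (nsmulAddMonoidHom 5 :
          ((((⟨1, 0, 0, -23577276, -23098167619⟩ : WeierstrassCurve ℤ).baseChange ℚ)).baseChange
            (v.adicCompletion ℚ)).toAffine.Point →+ _).ker ≤ 5) ∨
      (((⟨1, 0, 0, -23577276, -23098167619⟩ : WeierstrassCurve ℤ).baseChange ℚ).HasMultiplicativeReductionAt v ∧
        ((⟨1, 1, 1, -17985352701, 1881572323801248⟩ : WeierstrassCurve ℤ).baseChange ℚ).HasMultiplicativeReductionAt v ∧
        (∃ r : v.adicCompletion ℚ, algebraMap ℚ (v.adicCompletion ℚ)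
            (-(((⟨1, 0, 0, -23577276, -23098167619⟩ : WeierstrassCurve ℤ).baseChange ℚ).c₄ /
               ((⟨1, 0, 0, -23577276, -23098167619⟩ : WeierstrassCurve ℤ).baseChange ℚ).c₆)) =
          r ^ 2 * algebraMap ℚ (v.adicCompletion ℚ)
            (-(((⟨1, 1, 1, -17985352701, 1881572323801248⟩ : WeierstrassCurve ℤ).baseChange ℚ).c₄ /
               ((⟨1, 1, 1, -17985352701, 1881572323801248⟩ : WeierstrassCurve ℤ).baseChange ℚ).c₆))) ∧
        (∀ ζ : v.adicCompletion ℚ, ζ ^ 5 = 1 → ζ = 1))) :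
    Summit.BirchSwinnertonDyer.Rank1Residual.X11b.P2OpenInputOnTreeAt
      ((⟨1, 0, 0, -23577276, -23098167619⟩ : WeierstrassCurve ℤ).baseChange ℚ) 5 := by
  sorry

/-- **R4 · `stub_rung_shaDiv_D1_hesse` — PLAN-ONLY BC5 RUNG INSIDE THE RESIDUAL BRANCH (D), v5 (NEW): the open input at `(D1, 5)` with DATA =
`r_an(D1) = 1`, `#Ш(D1)_an = 25` ONLY.** Binders: the route's support items `PublishedInputsFive` (`hF`), `JSWAnticyclotomicControlMult` (`h331`), the
published Cassels–Tate pairing (`hCT`), Tate uniformisation (`hU`, `hU2`) and Fisher 2012 Thm. 13.2 (`hF13`, direct Hesse family — gives the 5-congruence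
V1[5] ≅ D1[5] from the kernel-checked certificate (41173:1), u = 1486314791574084160128000), and the two analytic data. The partner's rank, the bad places and
all local kinds are kernel theorems (p547615, p551017). Closed by name by `Theorems.Rest3Rungs.stub_rung_shaDiv_D1_hesse` (seat g6).
[cite: Fisher2012Hessian, Thm. 13.2 (n = 5)] [cite: CremonaMazur2000, §3 and Table 1] [cite: AgasheStein2002, Thm. 3.1 and §3.5]
[cite: JetchevSkinnerWan2017, Thm. 3.3.1, §7.4.1] [cite: Cremona1997, Table 1 (235a1, 7755i1)] -/
theorem stub_rung_shaDiv_D1_hesse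
    [((⟨1, 0, 0, -23577276, -23098167619⟩ : WeierstrassCurve ℤ).baseChange ℚ).IsElliptic]
    [((⟨1, 0, 0, -23577276, -23098167619⟩ : WeierstrassCurve ℤ).baseChange ℚ).IsGloballyMinimal]
    (hF : Summit.BirchSwinnertonDyer.BirchSwinnertonDyer.Theses.ErratumRoadFive.PublishedInputsFive)
    (h331 : Summit.BirchSwinnertonDyer.BirchSwinnertonDyer.Theses.ErratumRoadFive.JSWAnticyclotomicControlMult)
    (hCT : exists_casselsTate_pairing (K := ℚ))
    (hU : Silverman1994_thmV53_tateUniformisation.{0})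
    (hU2 : Silverman1994_thmV53_corV54_tateUniformisation.{0})
    (hF13 : Fisher2012.thm132_fiveCongruent_hessePencil)
    (hr : ((⟨1, 0, 0, -23577276, -23098167619⟩ : WeierstrassCurve ℤ).baseChange ℚ).analyticRank = 1)
    (hsha : shaAn ((⟨1, 0, 0, -23577276, -23098167619⟩ : WeierstrassCurve ℤ).baseChange ℚ) = ((25 : ℚ) : ℂ)) :
    Summit.BirchSwinnertonDyer.Rank1Residual.X11b.P2OpenInputOnTreeAt
      ((⟨1, 0, 0, -23577276, -23098167619⟩ : WeierstrassCurve ℤ).baseChange ℚ) 5 := by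
  sorry

/-- **R5 · `stub_rung_shaDiv_D2_hesse` — PLAN-ONLY BC5 RUNG INSIDE THE RESIDUAL BRANCH (D), v5 (NEW): the open input at `(D2, 5)`, D2 = 635b1 ⊗ (−2872) =
`⟨0, 1, 0, −5327081, −4755412951⟩` (`N = 5 237 723 840`, non-split at 5, `127` the (ram) witness, `#Ш(D2)_an = 25`), with DATA = `r_an(D2) = 1`,
`#Ш(D2)_an = 25` ONLY.** Binders as R4 with Fisher 2013 Thm. 5.8 (i) (`hF58`, indirect family — V2 = 72390y1 ⊗ (−2872) is the fibre (−84724:5),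
u = 850414155928926471568806316867584; an anti-symplectic congruence). The partner's rank `3 ≤ rank V2(ℚ)` (kernel 3-descent), the bad places, the paid
place `v₁₉` (`#V2(ℚ₁₉)[5] ≤ 5`) and the free kinds are kernel theorems (p549719, p551371). Closed by name by `Theorems.Rest3Rungs.stub_rung_shaDiv_D2_hesse`
(seat g6). [cite: Fisher2013QuinticTwists, Thm. 5.8] [cite: CremonaMazur2000, §3 and Table 1] [cite: AgasheStein2002, Thm. 3.1 and §3.5]
[cite: JetchevSkinnerWan2017, Thm. 3.3.1, §7.4.1] [cite: Cremona1997, Table 1 (635b1, 72390y1)] -/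
theorem stub_rung_shaDiv_D2_hesse
    [((⟨0, 1, 0, -5327081, -4755412951⟩ : WeierstrassCurve ℤ).baseChange ℚ).IsElliptic]
    [((⟨0, 1, 0, -5327081, -4755412951⟩ : WeierstrassCurve ℤ).baseChange ℚ).IsGloballyMinimal]
    (hF : Summit.BirchSwinnertonDyer.BirchSwinnertonDyer.Theses.ErratumRoadFive.PublishedInputsFive)
    (h331 : Summit.BirchSwinnertonDyer.BirchSwinnertonDyer.Theses.ErratumRoadFive.JSWAnticyclotomicControlMult)
    (hCT : exists_casselsTate_pairing (K := ℚ))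
    (hU : Silverman1994_thmV53_tateUniformisation.{0})
    (hU2 : Silverman1994_thmV53_corV54_tateUniformisation.{0})
    (hF58 : Fisher2012.thm58_fiveCongruent_hessePencilInd)
    (hr : ((⟨0, 1, 0, -5327081, -4755412951⟩ : WeierstrassCurve ℤ).baseChange ℚ).analyticRank = 1)
    (hsha : shaAn ((⟨0, 1, 0, -5327081, -4755412951⟩ : WeierstrassCurve ℤ).baseChange ℚ) = ((25 : ℚ) : ℂ)) :
    Summit.BirchSwinnertonDyer.Rank1Residual.X11b.P2OpenInputOnTreeAt
      ((⟨0, 1, 0, -5327081, -4755412951⟩ : WeierstrassCurve ℤ).baseChange ℚ) 5 := by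
  sorry

/-- **F · `stub_rest3_leverFacts` — CITABLE FACT BUNDLE (not a genuine stub; v7): the PUBLISHED inputs of the cyclotomic lever** —
Skinner 2016 Thm. A (cyclotomic IMC at a multiplicative `p` with (ram)), Stein–Wuthrich 2013 Thm. 6.1 (non-split ∕ split) and §4.2
(existence of the canonical heights), Disegni 2020 Thm. 1 (`p`-adic BSD in analytic rank one at a multiplicative `p`), modular
parametrisation — each a Literature named fact BY NAME (verbatim the (T) skeleton's `stub_t_leverFacts`; they are support items of the
K2@3 routes, not bound by `ErratumRoadFive`). Used only by the alternative composition `RamNoErratumDataAtFive_of_regulator` and by R6–R9.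
[cite: Skinner2016PacificMC, Thm. A (§1)] [cite: SteinWuthrich2013, Thm. 6.1 (p. 20), §4.2] [cite: Disegni2020, Thm. 1 (§1.2)] -/
theorem stub_rest3_leverFacts :
    Literature.NumberTheory.EllipticCurves.Skinner2016.thmA_charIdeal_multiplicative ∧
      Literature.NumberTheory.EllipticCurves.SteinWuthrich2013.thm61_nonsplitMultiplicative ∧
      Literature.NumberTheory.EllipticCurves.SteinWuthrich2013.thm61_splitMultiplicative ∧
      Literature.NumberTheory.EllipticCurves.SteinWuthrich2013.exists_isMultCanonical ∧
      Literature.NumberTheory.EllipticCurves.SteinWuthrich2013.exists_isSplitMultCanonical ∧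
      Literature.NumberTheory.EllipticCurves.Disegni2020.thm1_padicBSD_rankOne_multiplicative ∧
      Literature.NumberTheory.EllipticCurves.ModularForms.nonempty_modularParametrizationData := by
  sorry

/-- **SCH · `stub_shaDiv_regulatorNonvanishing` — GENUINE (v7, line 2): Schneider's non-degeneracy ON THE PAIRS OF BRANCH (D) ONLY** — at
every `(E, p)` in X11b with `p ≥ 5`, a (ram) prime, NO erratum datum and `ord_p s > 0` for every rational value `s` of `#Ш(E)_an`, the canonical
`p`-adic regulator is non-zero for THE Stein–Wuthrich §4.2 datum (`ClassClosure.RegulatorNonvanishingAt E p`, both reduction signs). Class-wide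
this is (a restriction of) Schneider's conjecture — OPEN, barrier `Literature.Barriers.BirchSwinnertonDyer.PAdicHeightNondegeneracy`, in print
only as a conjecture; PER PAIR it is a FINITE `5`-adic computation — v16 census: the bundled predicate is a KERNEL THEOREM modulo GZK at ALL 17
members of record of (D) ∪ TR (D0–D6: `RegMult.LeverD.*`; TR1 TR2 TR5: `RegMult.LeverTR.regulatorNonvanishingAt_TR{1,2,5}_baseChange_of_GZK`; TR3 TR4 TR6 TR7
TR8 TR9 TR10: `…Rest3TRLeverCertKernelSplit41{,B,C}.lean`, both halves — seat g7's ∕ g8's first-order checkers incl. the depth-`K` one, joined with tam3-p2's exact ∕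
regime-free split certificates), and numerically non-degenerate at all 15 174 REST⁗@5 pairs of Cremona's range (two engines), EVERY one of which carries a numerically verified certificate row
meeting a landed kernel row checker's criteria (HOME/rest/DEEPCENSUS-REST4at5.md v5 §7, seat g9: 15 174 ∕ 15 174).
With F and the two support items it implies SD (`Theorems.rest3ShaDivisibleBranchAtFive_of_items_of_leverFacts_of_regulatorOnD`, seat g7). The programme's
K2 road exists to AVOID this input; it is registered as the honest name of SD's residual on the only printed road that reaches (D).
[cite: Schneider1982PadicHeightI, §1] [cite: SteinWuthrich2013, §4.2 and Conj. 4.1] [cite: Skinner2016PacificMC, Thm. A (§1)] -/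
theorem stub_shaDiv_regulatorNonvanishing :
    ∀ (W : WeierstrassCurve ℚ) [W.IsElliptic] [W.IsGloballyMinimal] (p : ℕ) [Fact p.Prime],
      ClassX11b W p → 5 ≤ p → Literature.NumberTheory.EllipticCurves.Rank1Residual.Ram W p →
      ¬ ((∃ (q : ℕ) (_ : Fact q.Prime), q ≠ 2 ∧ q ≠ p ∧ Literature.NumberTheory.EllipticCurves.Rank1Residual.Mult W q ∧
          ¬ W.HasSplitMultiplicativeReductionAtPrime q ∧ ¬ p ∣ padicValInt q W.minimalDiscriminantInt) ∧
        (∀ P : (W.baseChange ℚ_[p]).toAffine.Point, p • P = 0 → P = 0)) →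
      (∀ s : ℚ, shaAn W = (s : ℂ) → 0 < padicValRat p s) →
      ClassClosure.RegulatorNonvanishingAt W p := by
  sorry

/-- **R6 · `stub_rung_shaDiv_D1_lever` — PLAN-ONLY BC5 RUNG INSIDE (D) ON THE LEVER (v7): the open input at `(D1, 5)`** (D1 = 235a1 ⊗ (−2167) =
`⟨1, 0, 0, -23577276, -23098167619⟩`, NON-split at `5`, a member of (D): `#Ш_an = 25` attested, HOME/rest/D-SEARCH.md) from the support items `PublishedInputsFive` (`hF`) +
`JSWAnticyclotomicControlMult` (`h331`) + the lever bundle F (`hL`) and NOTHING ELSE: the regulator input `RegulatorNonvanishingAt D1 5` is the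
KERNEL certificate `RegMult.LeverD.regulatorNonvanishingAt_D1_baseChange_of_GZK` (REG5CERT, Q = 6·g, depth 1, λ = 6; engine 2 PARI kit j287537), the (ram)
witness, irreducibility and non-splitness kernel-decided on the integer model. Closed BY NAME by `Theorems.Rest3Rungs.stub_rung_shaDiv_D1_lever`
(seat g7). [cite: Skinner2016PacificMC, Thm. A and Thm. C (§1)] [cite: SteinWuthrich2013, Thm. 6.1 (p. 20), §4.2] [cite: Disegni2020, Thm. 1 (§1.2)]
[cite: JetchevSkinnerWan2017, Thm. 3.3.1, §7.4.1] -/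
theorem stub_rung_shaDiv_D1_lever
    [((⟨1, 0, 0, -23577276, -23098167619⟩ : WeierstrassCurve ℤ).baseChange ℚ).IsElliptic]
    [((⟨1, 0, 0, -23577276, -23098167619⟩ : WeierstrassCurve ℤ).baseChange ℚ).IsGloballyMinimal]
    (hF : Summit.BirchSwinnertonDyer.BirchSwinnertonDyer.Theses.ErratumRoadFive.PublishedInputsFive)
    (h331 : Summit.BirchSwinnertonDyer.BirchSwinnertonDyer.Theses.ErratumRoadFive.JSWAnticyclotomicControlMult)
    (hL : Literature.NumberTheory.EllipticCurves.Skinner2016.thmA_charIdeal_multiplicative ∧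
      Literature.NumberTheory.EllipticCurves.SteinWuthrich2013.thm61_nonsplitMultiplicative ∧
      Literature.NumberTheory.EllipticCurves.SteinWuthrich2013.thm61_splitMultiplicative ∧
      Literature.NumberTheory.EllipticCurves.SteinWuthrich2013.exists_isMultCanonical ∧
      Literature.NumberTheory.EllipticCurves.SteinWuthrich2013.exists_isSplitMultCanonical ∧
      Literature.NumberTheory.EllipticCurves.Disegni2020.thm1_padicBSD_rankOne_multiplicative ∧
      Literature.NumberTheory.EllipticCurves.ModularForms.nonempty_modularParametrizationData) :
    Summit.BirchSwinnertonDyer.Rank1Residual.X11b.P2OpenInputOnTreeAt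
      ((⟨1, 0, 0, -23577276, -23098167619⟩ : WeierstrassCurve ℤ).baseChange ℚ) 5 := by
  sorry

/-- **R7 · `stub_rung_shaDiv_D2_lever` — PLAN-ONLY BC5 RUNG INSIDE (D) ON THE LEVER (v7): the open input at `(D2, 5)`** (D2 = 635b1 ⊗ (−2872) =
`⟨0, 1, 0, -5327081, -4755412951⟩`, NON-split at `5`, a member of (D): `#Ш_an = 25` attested, HOME/rest/D-SEARCH.md) from the support items `PublishedInputsFive` (`hF`) +
`JSWAnticyclotomicControlMult` (`h331`) + the lever bundle F (`hL`) and NOTHING ELSE: the regulator input `RegulatorNonvanishingAt D2 5` is the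
KERNEL certificate `RegMult.LeverD.regulatorNonvanishingAt_D2_baseChange_of_GZK` (REG5CERT, Q = 6·g, depth 1, λ = 22; engine 2 PARI kit j287537), the (ram)
witness, irreducibility and non-splitness kernel-decided on the integer model. Closed BY NAME by `Theorems.Rest3Rungs.stub_rung_shaDiv_D2_lever`
(seat g7). [cite: Skinner2016PacificMC, Thm. A and Thm. C (§1)] [cite: SteinWuthrich2013, Thm. 6.1 (p. 20), §4.2] [cite: Disegni2020, Thm. 1 (§1.2)]
[cite: JetchevSkinnerWan2017, Thm. 3.3.1, §7.4.1] -/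
theorem stub_rung_shaDiv_D2_lever
    [((⟨0, 1, 0, -5327081, -4755412951⟩ : WeierstrassCurve ℤ).baseChange ℚ).IsElliptic]
    [((⟨0, 1, 0, -5327081, -4755412951⟩ : WeierstrassCurve ℤ).baseChange ℚ).IsGloballyMinimal]
    (hF : Summit.BirchSwinnertonDyer.BirchSwinnertonDyer.Theses.ErratumRoadFive.PublishedInputsFive)
    (h331 : Summit.BirchSwinnertonDyer.BirchSwinnertonDyer.Theses.ErratumRoadFive.JSWAnticyclotomicControlMult)
    (hL : Literature.NumberTheory.EllipticCurves.Skinner2016.thmA_charIdeal_multiplicative ∧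
      Literature.NumberTheory.EllipticCurves.SteinWuthrich2013.thm61_nonsplitMultiplicative ∧
      Literature.NumberTheory.EllipticCurves.SteinWuthrich2013.thm61_splitMultiplicative ∧
      Literature.NumberTheory.EllipticCurves.SteinWuthrich2013.exists_isMultCanonical ∧
      Literature.NumberTheory.EllipticCurves.SteinWuthrich2013.exists_isSplitMultCanonical ∧
      Literature.NumberTheory.EllipticCurves.Disegni2020.thm1_padicBSD_rankOne_multiplicative ∧
      Literature.NumberTheory.EllipticCurves.ModularForms.nonempty_modularParametrizationData) :
    Summit.BirchSwinnertonDyer.Rank1Residual.X11b.P2OpenInputOnTreeAt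
      ((⟨0, 1, 0, -5327081, -4755412951⟩ : WeierstrassCurve ℤ).baseChange ℚ) 5 := by
  sorry

/-- **R8 · `stub_rung_shaDiv_D4_lever` — PLAN-ONLY BC5 RUNG INSIDE (D) ON THE LEVER (v7): the open input at `(D4, 5)`** (D4 = 995b1 ⊗ (−2363) =
`⟨0, 1, 1, -85617791, -320971224710⟩`, NON-split at `5`, a member of (D): `#Ш_an = 25` attested, HOME/rest/D-SEARCH.md) from the support items `PublishedInputsFive` (`hF`) +
`JSWAnticyclotomicControlMult` (`h331`) + the lever bundle F (`hL`) and NOTHING ELSE: the regulator input `RegulatorNonvanishingAt D4 5` is the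
KERNEL certificate `RegMult.LeverD.regulatorNonvanishingAt_D4_baseChange_of_GZK` (REG5CERT, Q = g, depth 2, λ = 33; engine 2 PARI kit j287537), the (ram)
witness, irreducibility and non-splitness kernel-decided on the integer model. Closed BY NAME by `Theorems.Rest3Rungs.stub_rung_shaDiv_D4_lever`
(seat g7). [cite: Skinner2016PacificMC, Thm. A and Thm. C (§1)] [cite: SteinWuthrich2013, Thm. 6.1 (p. 20), §4.2] [cite: Disegni2020, Thm. 1 (§1.2)]
[cite: JetchevSkinnerWan2017, Thm. 3.3.1, §7.4.1] -/
theorem stub_rung_shaDiv_D4_lever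
    [((⟨0, 1, 1, -85617791, -320971224710⟩ : WeierstrassCurve ℤ).baseChange ℚ).IsElliptic]
    [((⟨0, 1, 1, -85617791, -320971224710⟩ : WeierstrassCurve ℤ).baseChange ℚ).IsGloballyMinimal]
    (hF : Summit.BirchSwinnertonDyer.BirchSwinnertonDyer.Theses.ErratumRoadFive.PublishedInputsFive)
    (h331 : Summit.BirchSwinnertonDyer.BirchSwinnertonDyer.Theses.ErratumRoadFive.JSWAnticyclotomicControlMult)
    (hL : Literature.NumberTheory.EllipticCurves.Skinner2016.thmA_charIdeal_multiplicative ∧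
      Literature.NumberTheory.EllipticCurves.SteinWuthrich2013.thm61_nonsplitMultiplicative ∧
      Literature.NumberTheory.EllipticCurves.SteinWuthrich2013.thm61_splitMultiplicative ∧
      Literature.NumberTheory.EllipticCurves.SteinWuthrich2013.exists_isMultCanonical ∧
      Literature.NumberTheory.EllipticCurves.SteinWuthrich2013.exists_isSplitMultCanonical ∧
      Literature.NumberTheory.EllipticCurves.Disegni2020.thm1_padicBSD_rankOne_multiplicative ∧
      Literature.NumberTheory.EllipticCurves.ModularForms.nonempty_modularParametrizationData) :
    Summit.BirchSwinnertonDyer.Rank1Residual.X11b.P2OpenInputOnTreeAt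
      ((⟨0, 1, 1, -85617791, -320971224710⟩ : WeierstrassCurve ℤ).baseChange ℚ) 5 := by
  sorry

/-- **R9 · `stub_rung_shaDiv_D6_lever` — PLAN-ONLY BC5 RUNG INSIDE (D) ON THE LEVER (v7): the open input at `(D6, 5)`** (D6 = 985b1 ⊗ (−3963) =
`⟨0, 0, 1, -319342503, -1928875397967⟩`, NON-split at `5`, a member of (D): `#Ш_an = 25` attested, HOME/rest/D-SEARCH.md) from the support items `PublishedInputsFive` (`hF`) +
`JSWAnticyclotomicControlMult` (`h331`) + the lever bundle F (`hL`) and NOTHING ELSE: the regulator input `RegulatorNonvanishingAt D6 5` is the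
KERNEL certificate `RegMult.LeverD.regulatorNonvanishingAt_D6_baseChange_of_GZK` (REG5CERT, Q = 6·g, depth 2, λ = 106; engine 2 PARI kit j287537), the (ram)
witness, irreducibility and non-splitness kernel-decided on the integer model. Closed BY NAME by `Theorems.Rest3Rungs.stub_rung_shaDiv_D6_lever`
(seat g7). [cite: Skinner2016PacificMC, Thm. A and Thm. C (§1)] [cite: SteinWuthrich2013, Thm. 6.1 (p. 20), §4.2] [cite: Disegni2020, Thm. 1 (§1.2)]
[cite: JetchevSkinnerWan2017, Thm. 3.3.1, §7.4.1] -/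
theorem stub_rung_shaDiv_D6_lever
    [((⟨0, 0, 1, -319342503, -1928875397967⟩ : WeierstrassCurve ℤ).baseChange ℚ).IsElliptic]
    [((⟨0, 0, 1, -319342503, -1928875397967⟩ : WeierstrassCurve ℤ).baseChange ℚ).IsGloballyMinimal]
    (hF : Summit.BirchSwinnertonDyer.BirchSwinnertonDyer.Theses.ErratumRoadFive.PublishedInputsFive)
    (h331 : Summit.BirchSwinnertonDyer.BirchSwinnertonDyer.Theses.ErratumRoadFive.JSWAnticyclotomicControlMult)
    (hL : Literature.NumberTheory.EllipticCurves.Skinner2016.thmA_charIdeal_multiplicative ∧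
      Literature.NumberTheory.EllipticCurves.SteinWuthrich2013.thm61_nonsplitMultiplicative ∧
      Literature.NumberTheory.EllipticCurves.SteinWuthrich2013.thm61_splitMultiplicative ∧
      Literature.NumberTheory.EllipticCurves.SteinWuthrich2013.exists_isMultCanonical ∧
      Literature.NumberTheory.EllipticCurves.SteinWuthrich2013.exists_isSplitMultCanonical ∧
      Literature.NumberTheory.EllipticCurves.Disegni2020.thm1_padicBSD_rankOne_multiplicative ∧
      Literature.NumberTheory.EllipticCurves.ModularForms.nonempty_modularParametrizationData) :
    Summit.BirchSwinnertonDyer.Rank1Residual.X11b.P2OpenInputOnTreeAt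
      ((⟨0, 0, 1, -319342503, -1928875397967⟩ : WeierstrassCurve ℤ).baseChange ℚ) 5 := by
  sorry

/-- **R10 · `stub_rung_shaDiv_D5_lever` — PLAN-ONLY BC5 RUNG INSIDE (D) ON THE LEVER (v8): the open input at `(D5, 5)`** (D5 = 635b1 ⊗ (−3208) =
`⟨0, 1, 0, -6646441, -6627061835⟩`, NON-split at `5`, a member of (D): `#Ш_an = 25` attested, HOME/rest/D-SEARCH.md) from `PublishedInputsFive` (`hF`) +
`JSWAnticyclotomicControlMult` (`h331`) + the lever bundle F (`hL`) and NOTHING ELSE: the regulator input is the SECOND-ORDER kernel certificate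
`RegMult.LeverD.regulatorNonvanishingAt_D5_baseChange_of_GZK` (REG5CERT depth 1, Q = 6·g, residues λ = 106, Γ = 2, β = 86; `β⁴ − e'⁸ ≡ 100 (mod 125)`;
PARI `v₅(Reg) = 2`, kit j287537). Closed BY NAME by `Theorems.Rest3Rungs.stub_rung_shaDiv_D5_lever` (seat g7).
[cite: Skinner2016PacificMC, Thm. A and Thm. C (§1)] [cite: SteinWuthrich2013, Thm. 6.1 (p. 20), §4.2] [cite: Disegni2020, Thm. 1 (§1.2)]
[cite: JetchevSkinnerWan2017, Thm. 3.3.1, §7.4.1] -/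
theorem stub_rung_shaDiv_D5_lever
    [((⟨0, 1, 0, -6646441, -6627061835⟩ : WeierstrassCurve ℤ).baseChange ℚ).IsElliptic]
    [((⟨0, 1, 0, -6646441, -6627061835⟩ : WeierstrassCurve ℤ).baseChange ℚ).IsGloballyMinimal]
    (hF : Summit.BirchSwinnertonDyer.BirchSwinnertonDyer.Theses.ErratumRoadFive.PublishedInputsFive)
    (h331 : Summit.BirchSwinnertonDyer.BirchSwinnertonDyer.Theses.ErratumRoadFive.JSWAnticyclotomicControlMult)
    (hL : Literature.NumberTheory.EllipticCurves.Skinner2016.thmA_charIdeal_multiplicative ∧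
      Literature.NumberTheory.EllipticCurves.SteinWuthrich2013.thm61_nonsplitMultiplicative ∧
      Literature.NumberTheory.EllipticCurves.SteinWuthrich2013.thm61_splitMultiplicative ∧
      Literature.NumberTheory.EllipticCurves.SteinWuthrich2013.exists_isMultCanonical ∧
      Literature.NumberTheory.EllipticCurves.SteinWuthrich2013.exists_isSplitMultCanonical ∧
      Literature.NumberTheory.EllipticCurves.Disegni2020.thm1_padicBSD_rankOne_multiplicative ∧
      Literature.NumberTheory.EllipticCurves.ModularForms.nonempty_modularParametrizationData) :
    Summit.BirchSwinnertonDyer.Rank1Residual.X11b.P2OpenInputOnTreeAt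
      ((⟨0, 1, 0, -6646441, -6627061835⟩ : WeierstrassCurve ℤ).baseChange ℚ) 5 := by
  sorry

/-- **R11 · `stub_rung_shaDiv_D3_lever` — PLAN-ONLY BC5 RUNG INSIDE (D) ON THE LEVER (v9): the open input at `(D3, 5)`** (D3 = 985b1 ⊗ 2309 =
`⟨0, -1, 1, -108406780, 381544229003⟩`, SPLIT at `5` (I₄); Q = 16·g at depth one: (4.1) half first order (λ = 2), split half by the generic first-order split checker (Γ = 4, τ₁ = 2, δ = 4, μ = 4, τ₂ = 4; `5 ∤ τ₁ − τ₂`); PARI `v₅(Reg) = 1`, kit j287537) from `PublishedInputsFive` (`hF`) + `JSWAnticyclotomicControlMult` (`h331`) + the lever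
bundle F (`hL`) and NOTHING ELSE: the regulator input (both halves) is the kernel certificate `RegMult.LeverD.regulatorNonvanishingAt_D3_baseChange_of_GZK`
(`Theorems/ErratumRoadFiveRest3DLeverCertKernelSplit.lean`). Closed BY NAME by `Theorems.Rest3Rungs.stub_rung_shaDiv_D3_lever` (seat g7).
[cite: Skinner2016PacificMC, Thm. A and Thm. C (§1)] [cite: SteinWuthrich2013, Thm. 6.1 (p. 20), §4.2] [cite: Disegni2020, Thm. 1 (§1.2), (∗)]
[cite: JetchevSkinnerWan2017, Thm. 3.3.1, §7.4.1] -/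
theorem stub_rung_shaDiv_D3_lever
    [((⟨0, -1, 1, -108406780, 381544229003⟩ : WeierstrassCurve ℤ).baseChange ℚ).IsElliptic]
    [((⟨0, -1, 1, -108406780, 381544229003⟩ : WeierstrassCurve ℤ).baseChange ℚ).IsGloballyMinimal]
    (hF : Summit.BirchSwinnertonDyer.BirchSwinnertonDyer.Theses.ErratumRoadFive.PublishedInputsFive)
    (h331 : Summit.BirchSwinnertonDyer.BirchSwinnertonDyer.Theses.ErratumRoadFive.JSWAnticyclotomicControlMult)
    (hL : Literature.NumberTheory.EllipticCurves.Skinner2016.thmA_charIdeal_multiplicative ∧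
      Literature.NumberTheory.EllipticCurves.SteinWuthrich2013.thm61_nonsplitMultiplicative ∧
      Literature.NumberTheory.EllipticCurves.SteinWuthrich2013.thm61_splitMultiplicative ∧
      Literature.NumberTheory.EllipticCurves.SteinWuthrich2013.exists_isMultCanonical ∧
      Literature.NumberTheory.EllipticCurves.SteinWuthrich2013.exists_isSplitMultCanonical ∧
      Literature.NumberTheory.EllipticCurves.Disegni2020.thm1_padicBSD_rankOne_multiplicative ∧
      Literature.NumberTheory.EllipticCurves.ModularForms.nonempty_modularParametrizationData) :
    Summit.BirchSwinnertonDyer.Rank1Residual.X11b.P2OpenInputOnTreeAt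
      ((⟨0, -1, 1, -108406780, 381544229003⟩ : WeierstrassCurve ℤ).baseChange ℚ) 5 := by
  sorry

/-- **R12 · `stub_rung_shaDiv_D0_lever` — PLAN-ONLY BC5 RUNG INSIDE (D) ON THE LEVER (v9): the open input at `(D0, 5)`** (D0 = 1865b1 ⊗ 409 =
`⟨0, -1, 1, -38530390, -92042846507⟩`, SPLIT at `5` (I₂), the smallest-conductor member `N = 311 979 065`; Q = 8·g at depth one: (4.1) half SECOND order (λ = 18, β = 124, `β⁴ − e'⁸ ≡ 75 (mod 125)`), split half first order (τ₁ = 0, μ = 4, τ₂ = 4); PARI `v₅(Reg) = 1`, kit j287537) from `PublishedInputsFive` (`hF`) + `JSWAnticyclotomicControlMult` (`h331`) + the lever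
bundle F (`hL`) and NOTHING ELSE: the regulator input (both halves) is the kernel certificate `RegMult.LeverD.regulatorNonvanishingAt_D0_baseChange_of_GZK`
(`Theorems/ErratumRoadFiveRest3DLeverCertKernelSplit.lean`). Closed BY NAME by `Theorems.Rest3Rungs.stub_rung_shaDiv_D0_lever` (seat g7).
[cite: Skinner2016PacificMC, Thm. A and Thm. C (§1)] [cite: SteinWuthrich2013, Thm. 6.1 (p. 20), §4.2] [cite: Disegni2020, Thm. 1 (§1.2), (∗)]
[cite: JetchevSkinnerWan2017, Thm. 3.3.1, §7.4.1] -/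
theorem stub_rung_shaDiv_D0_lever
    [((⟨0, -1, 1, -38530390, -92042846507⟩ : WeierstrassCurve ℤ).baseChange ℚ).IsElliptic]
    [((⟨0, -1, 1, -38530390, -92042846507⟩ : WeierstrassCurve ℤ).baseChange ℚ).IsGloballyMinimal]
    (hF : Summit.BirchSwinnertonDyer.BirchSwinnertonDyer.Theses.ErratumRoadFive.PublishedInputsFive)
    (h331 : Summit.BirchSwinnertonDyer.BirchSwinnertonDyer.Theses.ErratumRoadFive.JSWAnticyclotomicControlMult)
    (hL : Literature.NumberTheory.EllipticCurves.Skinner2016.thmA_charIdeal_multiplicative ∧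
      Literature.NumberTheory.EllipticCurves.SteinWuthrich2013.thm61_nonsplitMultiplicative ∧
      Literature.NumberTheory.EllipticCurves.SteinWuthrich2013.thm61_splitMultiplicative ∧
      Literature.NumberTheory.EllipticCurves.SteinWuthrich2013.exists_isMultCanonical ∧
      Literature.NumberTheory.EllipticCurves.SteinWuthrich2013.exists_isSplitMultCanonical ∧
      Literature.NumberTheory.EllipticCurves.Disegni2020.thm1_padicBSD_rankOne_multiplicative ∧
      Literature.NumberTheory.EllipticCurves.ModularForms.nonempty_modularParametrizationData) :
    Summit.BirchSwinnertonDyer.Rank1Residual.X11b.P2OpenInputOnTreeAt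
      ((⟨0, -1, 1, -38530390, -92042846507⟩ : WeierstrassCurve ℤ).baseChange ℚ) 5 := by
  sorry

/-- **R13 · `stub_rung_shaDiv_TR1_lever` — PLAN-ONLY BC5 RUNG AT A MEMBER OF TR = SD ∩ REST⁗ ON THE LEVER (v10): the open input at `(TR1, 5)`**
(TR1 = 1610g1 ⊗ 5653 = `⟨1, 0, 1, -291443115839, 58037627812656786⟩`, `N = 51 449 818 490`, non-split at 5, carrier `c₇ = 5`, `∏c = 80`, `#Ш_an = 25` attested; Q = 10·g at depth two, PRECISION FOUR (λ = 397 mod 625, `λ⁸ − e'⁸ ≡ 125 (mod 625)`); PARI `v₅(Reg) = 1`, kit j290911) from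
`PublishedInputsFive` (`hF`) + `JSWAnticyclotomicControlMult` (`h331`) + the lever bundle F (`hL`) and NOTHING ELSE: the regulator input is the kernel
certificate `RegMult.LeverTR.regulatorNonvanishingAt_TR1_baseChange_of_GZK` (`Theorems/ErratumRoadFiveRest3TRLeverCertKernel.lean`). Closed BY NAME by
`Theorems.Rest3Rungs.stub_rung_shaDiv_TR1_lever` (seat g7). [cite: Skinner2016PacificMC, Thm. A and Thm. C (§1)] [cite: SteinWuthrich2013, Thm. 6.1 (p. 20), §4.2]
[cite: Disegni2020, Thm. 1 (§1.2)] [cite: JetchevSkinnerWan2017, Thm. 3.3.1, §7.4.1] -/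
theorem stub_rung_shaDiv_TR1_lever
    [((⟨1, 0, 1, -291443115839, 58037627812656786⟩ : WeierstrassCurve ℤ).baseChange ℚ).IsElliptic]
    [((⟨1, 0, 1, -291443115839, 58037627812656786⟩ : WeierstrassCurve ℤ).baseChange ℚ).IsGloballyMinimal]
    (hF : Summit.BirchSwinnertonDyer.BirchSwinnertonDyer.Theses.ErratumRoadFive.PublishedInputsFive)
    (h331 : Summit.BirchSwinnertonDyer.BirchSwinnertonDyer.Theses.ErratumRoadFive.JSWAnticyclotomicControlMult)
    (hL : Literature.NumberTheory.EllipticCurves.Skinner2016.thmA_charIdeal_multiplicative ∧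
      Literature.NumberTheory.EllipticCurves.SteinWuthrich2013.thm61_nonsplitMultiplicative ∧
      Literature.NumberTheory.EllipticCurves.SteinWuthrich2013.thm61_splitMultiplicative ∧
      Literature.NumberTheory.EllipticCurves.SteinWuthrich2013.exists_isMultCanonical ∧
      Literature.NumberTheory.EllipticCurves.SteinWuthrich2013.exists_isSplitMultCanonical ∧
      Literature.NumberTheory.EllipticCurves.Disegni2020.thm1_padicBSD_rankOne_multiplicative ∧
      Literature.NumberTheory.EllipticCurves.ModularForms.nonempty_modularParametrizationData) :
    Summit.BirchSwinnertonDyer.Rank1Residual.X11b.P2OpenInputOnTreeAt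
      ((⟨1, 0, 1, -291443115839, 58037627812656786⟩ : WeierstrassCurve ℤ).baseChange ℚ) 5 := by
  sorry

/-- **R14 · `stub_rung_shaDiv_TR2_lever` — PLAN-ONLY BC5 RUNG AT A MEMBER OF TR = SD ∩ REST⁗ ON THE LEVER (v10): the open input at `(TR2, 5)`**
(TR2 = 665a1 ⊗ 6469 = `⟨1, 1, 0, 2677397672, 62676839562653⟩`, `N = 27 828 894 065`, non-split at 5, carrier `c₇ = 5`, `∏c = 20`, `#Ш_an = 25` attested; Q = 30·g at depth two, precision four (λ = 57, residue 125); PARI `v₅(Reg) = 1`, kit j290911) from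
`PublishedInputsFive` (`hF`) + `JSWAnticyclotomicControlMult` (`h331`) + the lever bundle F (`hL`) and NOTHING ELSE: the regulator input is the kernel
certificate `RegMult.LeverTR.regulatorNonvanishingAt_TR2_baseChange_of_GZK` (`Theorems/ErratumRoadFiveRest3TRLeverCertKernel.lean`). Closed BY NAME by
`Theorems.Rest3Rungs.stub_rung_shaDiv_TR2_lever` (seat g7). [cite: Skinner2016PacificMC, Thm. A and Thm. C (§1)] [cite: SteinWuthrich2013, Thm. 6.1 (p. 20), §4.2]
[cite: Disegni2020, Thm. 1 (§1.2)] [cite: JetchevSkinnerWan2017, Thm. 3.3.1, §7.4.1] -/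
theorem stub_rung_shaDiv_TR2_lever
    [((⟨1, 1, 0, 2677397672, 62676839562653⟩ : WeierstrassCurve ℤ).baseChange ℚ).IsElliptic]
    [((⟨1, 1, 0, 2677397672, 62676839562653⟩ : WeierstrassCurve ℤ).baseChange ℚ).IsGloballyMinimal]
    (hF : Summit.BirchSwinnertonDyer.BirchSwinnertonDyer.Theses.ErratumRoadFive.PublishedInputsFive)
    (h331 : Summit.BirchSwinnertonDyer.BirchSwinnertonDyer.Theses.ErratumRoadFive.JSWAnticyclotomicControlMult)
    (hL : Literature.NumberTheory.EllipticCurves.Skinner2016.thmA_charIdeal_multiplicative ∧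
      Literature.NumberTheory.EllipticCurves.SteinWuthrich2013.thm61_nonsplitMultiplicative ∧
      Literature.NumberTheory.EllipticCurves.SteinWuthrich2013.thm61_splitMultiplicative ∧
      Literature.NumberTheory.EllipticCurves.SteinWuthrich2013.exists_isMultCanonical ∧
      Literature.NumberTheory.EllipticCurves.SteinWuthrich2013.exists_isSplitMultCanonical ∧
      Literature.NumberTheory.EllipticCurves.Disegni2020.thm1_padicBSD_rankOne_multiplicative ∧
      Literature.NumberTheory.EllipticCurves.ModularForms.nonempty_modularParametrizationData) :
    Summit.BirchSwinnertonDyer.Rank1Residual.X11b.P2OpenInputOnTreeAt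
      ((⟨1, 1, 0, 2677397672, 62676839562653⟩ : WeierstrassCurve ℤ).baseChange ℚ) 5 := by
  sorry

/-- **R15 · `stub_rung_shaDiv_TR5_lever` — PLAN-ONLY BC5 RUNG AT A DEEP MEMBER OF TR = SD ∩ REST⁗ ON THE LEVER (v12): the open input at `(TR5, 5)`**
(TR5 = 3290b1 ⊗ 2029 = `⟨1, 1, 1, -67530687111, -6754389950852611⟩`, `N = 13 544 406 890 = 2·5·7·47·2029²`, NON-split `I₂` at 5, carrier `c₂ = 10`, `∏c = 40`, (ram) `47`, `#Ш_an = 25` attested; `Q = 6·g` at level two, `v₅(ĥ(Q)) = 1`, decided by tam3-p2's exact row checker `certNonsplit_TR5` (p592576: `5⁹ ∤ M`); PARI `v₅(Reg) = 1`, kit j290911; join `RegMult.LeverTR.regulatorNonvanishingAt_TR5_baseChange_of_GZK`, p594115) from `PublishedInputsFive` (`hF`) + `JSWAnticyclotomicControlMult` (`h331`) + the lever bundle F (`hL`) and NOTHING ELSE: the regulator input is a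
KERNEL certificate by seat tam3-p2's exact row checker, joined by this seat. Closed BY NAME by `Theorems.Rest3Rungs.stub_rung_shaDiv_TR5_lever` (seat g8).
[cite: Skinner2016PacificMC, Thm. A and Thm. C (§1)] [cite: SteinWuthrich2013, Thm. 6.1 (p. 20), §4.2] [cite: Disegni2020, Thm. 1 (§1.2)]
[cite: JetchevSkinnerWan2017, Thm. 3.3.1, §7.4.1] -/
theorem stub_rung_shaDiv_TR5_lever
    [((⟨1, 1, 1, -67530687111, -6754389950852611⟩ : WeierstrassCurve ℤ).baseChange ℚ).IsElliptic]
    [((⟨1, 1, 1, -67530687111, -6754389950852611⟩ : WeierstrassCurve ℤ).baseChange ℚ).IsGloballyMinimal]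
    (hF : Summit.BirchSwinnertonDyer.BirchSwinnertonDyer.Theses.ErratumRoadFive.PublishedInputsFive)
    (h331 : Summit.BirchSwinnertonDyer.BirchSwinnertonDyer.Theses.ErratumRoadFive.JSWAnticyclotomicControlMult)
    (hL : Literature.NumberTheory.EllipticCurves.Skinner2016.thmA_charIdeal_multiplicative ∧
      Literature.NumberTheory.EllipticCurves.SteinWuthrich2013.thm61_nonsplitMultiplicative ∧
      Literature.NumberTheory.EllipticCurves.SteinWuthrich2013.thm61_splitMultiplicative ∧
      Literature.NumberTheory.EllipticCurves.SteinWuthrich2013.exists_isMultCanonical ∧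
      Literature.NumberTheory.EllipticCurves.SteinWuthrich2013.exists_isSplitMultCanonical ∧
      Literature.NumberTheory.EllipticCurves.Disegni2020.thm1_padicBSD_rankOne_multiplicative ∧
      Literature.NumberTheory.EllipticCurves.ModularForms.nonempty_modularParametrizationData) :
    Summit.BirchSwinnertonDyer.Rank1Residual.X11b.P2OpenInputOnTreeAt
      ((⟨1, 1, 1, -67530687111, -6754389950852611⟩ : WeierstrassCurve ℤ).baseChange ℚ) 5 := by
  sorry

/-- **R16 · `stub_rung_shaDiv_TR3_lever` — PLAN-ONLY BC5 RUNG AT A DEEP MEMBER OF TR = SD ∩ REST⁗ ON THE LEVER (v12): the open input at `(TR3, 5)`**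
(TR3 = 430b1 ⊗ 6729 = `⟨1, -1, 0, 715981161, -1837812563677⟩`, `N = 19 470 159 630 = 2·3²·5·43·2243²`, SPLIT `I₅` at 5 (`c₅ = 5`, the carrier), (ram) `43`, `#Ш_an = 25` attested; `Q = 50·g` at level two, `v₅(ĥ^{split}(Q)) = 6`, tam3-p2's exact SPLIT row checker `certSplit_TR3` (p593873); PARI `v₅(Reg) = 2`; join `Theorems.bsdp_TR3_lever` via `RegMult.bsdp_of_ram_split_of_five_le_of_cert`) from `PublishedInputsFive` (`hF`) + `JSWAnticyclotomicControlMult` (`h331`) + the lever bundle F (`hL`) and NOTHING ELSE: the regulator input is a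
KERNEL certificate by seat tam3-p2's exact row checker, joined by this seat. Closed BY NAME by `Theorems.Rest3Rungs.stub_rung_shaDiv_TR3_lever` (seat g8).
[cite: Skinner2016PacificMC, Thm. A and Thm. C (§1)] [cite: SteinWuthrich2013, Thm. 6.1 (p. 20), §4.2] [cite: Disegni2020, Thm. 1 (§1.2)]
[cite: JetchevSkinnerWan2017, Thm. 3.3.1, §7.4.1] -/
theorem stub_rung_shaDiv_TR3_lever
    [((⟨1, -1, 0, 715981161, -1837812563677⟩ : WeierstrassCurve ℤ).baseChange ℚ).IsElliptic]
    [((⟨1, -1, 0, 715981161, -1837812563677⟩ : WeierstrassCurve ℤ).baseChange ℚ).IsGloballyMinimal]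
    (hF : Summit.BirchSwinnertonDyer.BirchSwinnertonDyer.Theses.ErratumRoadFive.PublishedInputsFive)
    (h331 : Summit.BirchSwinnertonDyer.BirchSwinnertonDyer.Theses.ErratumRoadFive.JSWAnticyclotomicControlMult)
    (hL : Literature.NumberTheory.EllipticCurves.Skinner2016.thmA_charIdeal_multiplicative ∧
      Literature.NumberTheory.EllipticCurves.SteinWuthrich2013.thm61_nonsplitMultiplicative ∧
      Literature.NumberTheory.EllipticCurves.SteinWuthrich2013.thm61_splitMultiplicative ∧
      Literature.NumberTheory.EllipticCurves.SteinWuthrich2013.exists_isMultCanonical ∧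
      Literature.NumberTheory.EllipticCurves.SteinWuthrich2013.exists_isSplitMultCanonical ∧
      Literature.NumberTheory.EllipticCurves.Disegni2020.thm1_padicBSD_rankOne_multiplicative ∧
      Literature.NumberTheory.EllipticCurves.ModularForms.nonempty_modularParametrizationData) :
    Summit.BirchSwinnertonDyer.Rank1Residual.X11b.P2OpenInputOnTreeAt
      ((⟨1, -1, 0, 715981161, -1837812563677⟩ : WeierstrassCurve ℤ).baseChange ℚ) 5 := by
  sorry

/-- **R17 · `stub_rung_shaDiv_TR4_lever` — PLAN-ONLY BC5 RUNG AT A DEEP MEMBER OF TR = SD ∩ REST⁗ ON THE LEVER (v12): the open input at `(TR4, 5)`**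
(TR4 = 1120g1 ⊗ (−2371) = `⟨0, 1, 0, 194883555, -5979185695957⟩`, `N = 6 296 237 920 = 2⁵·5·7·2371²`, SPLIT `I₅` at 5 (`c₅ = 5`), (ram) `7`, `#Ш_an = 25` attested; `Q = 20·g` at level one, `v₅(ĥ^{split}(Q)) = 3`, `certSplit_TR4` (p593873); PARI `v₅(Reg) = 1`) from `PublishedInputsFive` (`hF`) + `JSWAnticyclotomicControlMult` (`h331`) + the lever bundle F (`hL`) and NOTHING ELSE: the regulator input is a
KERNEL certificate by seat tam3-p2's exact row checker, joined by this seat. Closed BY NAME by `Theorems.Rest3Rungs.stub_rung_shaDiv_TR4_lever` (seat g8).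
[cite: Skinner2016PacificMC, Thm. A and Thm. C (§1)] [cite: SteinWuthrich2013, Thm. 6.1 (p. 20), §4.2] [cite: Disegni2020, Thm. 1 (§1.2)]
[cite: JetchevSkinnerWan2017, Thm. 3.3.1, §7.4.1] -/
theorem stub_rung_shaDiv_TR4_lever
    [((⟨0, 1, 0, 194883555, -5979185695957⟩ : WeierstrassCurve ℤ).baseChange ℚ).IsElliptic]
    [((⟨0, 1, 0, 194883555, -5979185695957⟩ : WeierstrassCurve ℤ).baseChange ℚ).IsGloballyMinimal]
    (hF : Summit.BirchSwinnertonDyer.BirchSwinnertonDyer.Theses.ErratumRoadFive.PublishedInputsFive)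
    (h331 : Summit.BirchSwinnertonDyer.BirchSwinnertonDyer.Theses.ErratumRoadFive.JSWAnticyclotomicControlMult)
    (hL : Literature.NumberTheory.EllipticCurves.Skinner2016.thmA_charIdeal_multiplicative ∧
      Literature.NumberTheory.EllipticCurves.SteinWuthrich2013.thm61_nonsplitMultiplicative ∧
      Literature.NumberTheory.EllipticCurves.SteinWuthrich2013.thm61_splitMultiplicative ∧
      Literature.NumberTheory.EllipticCurves.SteinWuthrich2013.exists_isMultCanonical ∧
      Literature.NumberTheory.EllipticCurves.SteinWuthrich2013.exists_isSplitMultCanonical ∧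
      Literature.NumberTheory.EllipticCurves.Disegni2020.thm1_padicBSD_rankOne_multiplicative ∧
      Literature.NumberTheory.EllipticCurves.ModularForms.nonempty_modularParametrizationData) :
    Summit.BirchSwinnertonDyer.Rank1Residual.X11b.P2OpenInputOnTreeAt
      ((⟨0, 1, 0, 194883555, -5979185695957⟩ : WeierstrassCurve ℤ).baseChange ℚ) 5 := by
  sorry

/-- **R18 · `stub_rung_shaDiv_TR6_lever` — PLAN-ONLY BC5 RUNG AT A DEEP MEMBER OF TR = SD ∩ REST⁗ ON THE LEVER (v12): the open input at `(TR6, 5)`**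
(TR6 = 3445b1 ⊗ (−1591) = `⟨1, 1, 1, -101303975, -484661462390⟩`, `N = 8 720 263 045 = 5·13·37²·43²·53`, SPLIT `I₅` at 5 with `E(ℚ₅)[5] ≠ 0` — **the first member of record of the (T) branch `Rest3TorsionBranchAtFive` (crux 19702) with `5 ∣ #Ш_an`**, (ram) `13`, `∏c = 5`; `Q = 20·g` at level two, `v₅(ĥ^{split}(Q)) = 2`, `certSplit_TR6` (p593873); PARI `v₅(Reg) = 0`) from `PublishedInputsFive` (`hF`) + `JSWAnticyclotomicControlMult` (`h331`) + the lever bundle F (`hL`) and NOTHING ELSE: the regulator input is a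
KERNEL certificate by seat tam3-p2's exact row checker, joined by this seat. Closed BY NAME by `Theorems.Rest3Rungs.stub_rung_shaDiv_TR6_lever` (seat g8).
[cite: Skinner2016PacificMC, Thm. A and Thm. C (§1)] [cite: SteinWuthrich2013, Thm. 6.1 (p. 20), §4.2] [cite: Disegni2020, Thm. 1 (§1.2)]
[cite: JetchevSkinnerWan2017, Thm. 3.3.1, §7.4.1] -/
theorem stub_rung_shaDiv_TR6_lever
    [((⟨1, 1, 1, -101303975, -484661462390⟩ : WeierstrassCurve ℤ).baseChange ℚ).IsElliptic]
    [((⟨1, 1, 1, -101303975, -484661462390⟩ : WeierstrassCurve ℤ).baseChange ℚ).IsGloballyMinimal]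
    (hF : Summit.BirchSwinnertonDyer.BirchSwinnertonDyer.Theses.ErratumRoadFive.PublishedInputsFive)
    (h331 : Summit.BirchSwinnertonDyer.BirchSwinnertonDyer.Theses.ErratumRoadFive.JSWAnticyclotomicControlMult)
    (hL : Literature.NumberTheory.EllipticCurves.Skinner2016.thmA_charIdeal_multiplicative ∧
      Literature.NumberTheory.EllipticCurves.SteinWuthrich2013.thm61_nonsplitMultiplicative ∧
      Literature.NumberTheory.EllipticCurves.SteinWuthrich2013.thm61_splitMultiplicative ∧
      Literature.NumberTheory.EllipticCurves.SteinWuthrich2013.exists_isMultCanonical ∧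
      Literature.NumberTheory.EllipticCurves.SteinWuthrich2013.exists_isSplitMultCanonical ∧
      Literature.NumberTheory.EllipticCurves.Disegni2020.thm1_padicBSD_rankOne_multiplicative ∧
      Literature.NumberTheory.EllipticCurves.ModularForms.nonempty_modularParametrizationData) :
    Summit.BirchSwinnertonDyer.Rank1Residual.X11b.P2OpenInputOnTreeAt
      ((⟨1, 1, 1, -101303975, -484661462390⟩ : WeierstrassCurve ℤ).baseChange ℚ) 5 := by
  sorry

/-- **R19 · `stub_rung_shaDiv_TR10_lever` — PLAN-ONLY BC5 RUNG AT A DEEP MEMBER OF TR = SD ∩ REST⁗ ON THE LEVER (v12): the open input at `(TR10, 5)`**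
(TR10 = 3435c1 ⊗ (−2123) = `⟨0, 1, 1, -592851222520, -175698147295173101⟩`, `N = 15 481 988 115 = 3·5·11²·193²·229`, SPLIT `I₅` at 5 (`c₅ = 5`; second carrier `c₃ = 5`), (ram) `229`, `∏c = 100`; `Q = 10·g` at level one, `v₅(ĥ^{split}(Q)) = 2`, `certSplit_TR10` (p593873); PARI `v₅(Reg) = 0`) from `PublishedInputsFive` (`hF`) + `JSWAnticyclotomicControlMult` (`h331`) + the lever bundle F (`hL`) and NOTHING ELSE: the regulator input is a
KERNEL certificate by seat tam3-p2's exact row checker, joined by this seat. Closed BY NAME by `Theorems.Rest3Rungs.stub_rung_shaDiv_TR10_lever` (seat g8).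
[cite: Skinner2016PacificMC, Thm. A and Thm. C (§1)] [cite: SteinWuthrich2013, Thm. 6.1 (p. 20), §4.2] [cite: Disegni2020, Thm. 1 (§1.2)]
[cite: JetchevSkinnerWan2017, Thm. 3.3.1, §7.4.1] -/
theorem stub_rung_shaDiv_TR10_lever
    [((⟨0, 1, 1, -592851222520, -175698147295173101⟩ : WeierstrassCurve ℤ).baseChange ℚ).IsElliptic]
    [((⟨0, 1, 1, -592851222520, -175698147295173101⟩ : WeierstrassCurve ℤ).baseChange ℚ).IsGloballyMinimal]
    (hF : Summit.BirchSwinnertonDyer.BirchSwinnertonDyer.Theses.ErratumRoadFive.PublishedInputsFive)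
    (h331 : Summit.BirchSwinnertonDyer.BirchSwinnertonDyer.Theses.ErratumRoadFive.JSWAnticyclotomicControlMult)
    (hL : Literature.NumberTheory.EllipticCurves.Skinner2016.thmA_charIdeal_multiplicative ∧
      Literature.NumberTheory.EllipticCurves.SteinWuthrich2013.thm61_nonsplitMultiplicative ∧
      Literature.NumberTheory.EllipticCurves.SteinWuthrich2013.thm61_splitMultiplicative ∧
      Literature.NumberTheory.EllipticCurves.SteinWuthrich2013.exists_isMultCanonical ∧
      Literature.NumberTheory.EllipticCurves.SteinWuthrich2013.exists_isSplitMultCanonical ∧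
      Literature.NumberTheory.EllipticCurves.Disegni2020.thm1_padicBSD_rankOne_multiplicative ∧
      Literature.NumberTheory.EllipticCurves.ModularForms.nonempty_modularParametrizationData) :
    Summit.BirchSwinnertonDyer.Rank1Residual.X11b.P2OpenInputOnTreeAt
      ((⟨0, 1, 1, -592851222520, -175698147295173101⟩ : WeierstrassCurve ℤ).baseChange ℚ) 5 := by
  sorry

/-- **R20 · `stub_rung_shaDiv_TR9_lever` — PLAN-ONLY BC5 RUNG AT A DEEP MEMBER OF TR = SD ∩ REST⁗ ON THE LEVER (v13): the open input at `(TR9, 5)`**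
(TR9 = 2480g1 ⊗ 2861 = `⟨0, 0, 0, -314741963092, 67964403525151724⟩`, `N = 20 299 596 080 = 2⁴·5·31·2861²`, SPLIT `I₅` at 5 (`c₅ = 5`), second carrier `c₃₁ = 3`, (ram) `31` (`v₃₁(Δ) = 3`), `∏c = 15`,
`#Ш_an = 25` attested; `Q = 60·g` at level one, `v₅(ĥ^{split}(Q)) = 3`, tam3-p2's exact SPLIT row checker `certSplit_TR9` (p594737, 17 653-digit numeral); PARI `v₅(Reg) = 1`) from
`PublishedInputsFive` (`hF`) + `JSWAnticyclotomicControlMult` (`h331`) + the lever bundle F (`hL`) and NOTHING ELSE. Closed BY NAME by `Theorems.Rest3Rungs.stub_rung_shaDiv_TR9_lever`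
(seat g8). [cite: Skinner2016PacificMC, Thm. A and Thm. C (§1)] [cite: SteinWuthrich2013, Thm. 6.1 (p. 20), §4.2] [cite: Disegni2020, Thm. 1 (§1.2)]
[cite: JetchevSkinnerWan2017, Thm. 3.3.1, §7.4.1] -/
theorem stub_rung_shaDiv_TR9_lever
    [((⟨0, 0, 0, -314741963092, 67964403525151724⟩ : WeierstrassCurve ℤ).baseChange ℚ).IsElliptic]
    [((⟨0, 0, 0, -314741963092, 67964403525151724⟩ : WeierstrassCurve ℤ).baseChange ℚ).IsGloballyMinimal]
    (hF : Summit.BirchSwinnertonDyer.BirchSwinnertonDyer.Theses.ErratumRoadFive.PublishedInputsFive)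
    (h331 : Summit.BirchSwinnertonDyer.BirchSwinnertonDyer.Theses.ErratumRoadFive.JSWAnticyclotomicControlMult)
    (hL : Literature.NumberTheory.EllipticCurves.Skinner2016.thmA_charIdeal_multiplicative ∧
      Literature.NumberTheory.EllipticCurves.SteinWuthrich2013.thm61_nonsplitMultiplicative ∧
      Literature.NumberTheory.EllipticCurves.SteinWuthrich2013.thm61_splitMultiplicative ∧
      Literature.NumberTheory.EllipticCurves.SteinWuthrich2013.exists_isMultCanonical ∧
      Literature.NumberTheory.EllipticCurves.SteinWuthrich2013.exists_isSplitMultCanonical ∧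
      Literature.NumberTheory.EllipticCurves.Disegni2020.thm1_padicBSD_rankOne_multiplicative ∧
      Literature.NumberTheory.EllipticCurves.ModularForms.nonempty_modularParametrizationData) :
    Summit.BirchSwinnertonDyer.Rank1Residual.X11b.P2OpenInputOnTreeAt
      ((⟨0, 0, 0, -314741963092, 67964403525151724⟩ : WeierstrassCurve ℤ).baseChange ℚ) 5 := by
  sorry

/-- **R21 · `stub_rung_shaDiv_TR7_lever` — PLAN-ONLY BC5 RUNG AT A DEEP MEMBER OF TR = SD ∩ REST⁗ ON THE LEVER (v14): the open input at `(TR7, 5)`**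
(TR7 = 1770b1 ⊗ 2557 = `⟨1, 0, 0, 107744895, 14656843485⟩`, `N = 11 572 700 730 = 2·3·5·59·2557²`, SPLIT `I₁` at 5 (`ν = 1`; carriers `c₃ = 5`, `c₂ = 2`), (ram) `59`, `#Ш_an = 25` attested; `Q = 10·g` at level two, `v₅(ĥ^{split}(Q)) = 1`, `certSplit_TR7` (`…ExactPRowsTRCert`); PARI `v₅(Reg) = −1`) from `PublishedInputsFive` (`hF`) + `JSWAnticyclotomicControlMult` (`h331`) + the lever bundle F (`hL`) and NOTHING ELSE: the regulator input is a
KERNEL certificate by seat tam3-p2's regime-free split row checker, joined by this seat. Closed BY NAME by `Theorems.Rest3Rungs.stub_rung_shaDiv_TR7_lever` (seat g8).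
[cite: Skinner2016PacificMC, Thm. A and Thm. C (§1)] [cite: SteinWuthrich2013, Thm. 6.1 (p. 20), §4.2] [cite: Disegni2020, Thm. 1 (§1.2)]
[cite: JetchevSkinnerWan2017, Thm. 3.3.1, §7.4.1] -/
theorem stub_rung_shaDiv_TR7_lever
    [((⟨1, 0, 0, 107744895, 14656843485⟩ : WeierstrassCurve ℤ).baseChange ℚ).IsElliptic]
    [((⟨1, 0, 0, 107744895, 14656843485⟩ : WeierstrassCurve ℤ).baseChange ℚ).IsGloballyMinimal]
    (hF : Summit.BirchSwinnertonDyer.BirchSwinnertonDyer.Theses.ErratumRoadFive.PublishedInputsFive)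
    (h331 : Summit.BirchSwinnertonDyer.BirchSwinnertonDyer.Theses.ErratumRoadFive.JSWAnticyclotomicControlMult)
    (hL : Literature.NumberTheory.EllipticCurves.Skinner2016.thmA_charIdeal_multiplicative ∧
      Literature.NumberTheory.EllipticCurves.SteinWuthrich2013.thm61_nonsplitMultiplicative ∧
      Literature.NumberTheory.EllipticCurves.SteinWuthrich2013.thm61_splitMultiplicative ∧
      Literature.NumberTheory.EllipticCurves.SteinWuthrich2013.exists_isMultCanonical ∧
      Literature.NumberTheory.EllipticCurves.SteinWuthrich2013.exists_isSplitMultCanonical ∧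
      Literature.NumberTheory.EllipticCurves.Disegni2020.thm1_padicBSD_rankOne_multiplicative ∧
      Literature.NumberTheory.EllipticCurves.ModularForms.nonempty_modularParametrizationData) :
    Summit.BirchSwinnertonDyer.Rank1Residual.X11b.P2OpenInputOnTreeAt
      ((⟨1, 0, 0, 107744895, 14656843485⟩ : WeierstrassCurve ℤ).baseChange ℚ) 5 := by
  sorry

/-- **R22 · `stub_rung_shaDiv_TR8_lever` — PLAN-ONLY BC5 RUNG AT A DEEP MEMBER OF TR = SD ∩ REST⁗ ON THE LEVER (v14): the open input at `(TR8, 5)`**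
(TR8 = 3510j1 ⊗ 857 = `⟨1, -1, 0, -1476380199, -21149829976195⟩`, `N = 2 577 915 990 = 2·3³·5·13·857²` (smallest TR conductor), SPLIT `I₂` at 5 (`ν = 2 = v_L`; carrier `c₁₃ = 5`), (ram) witness `2` only (non-split, `v₂(Δ) = 7`), `#Ш_an = 25` attested; `Q = 40·g` at level three, `v₅(ĥ^{split}(Q)) = 2`, `certSplit_TR8`; PARI `v₅(Reg) = 0`) from `PublishedInputsFive` (`hF`) + `JSWAnticyclotomicControlMult` (`h331`) + the lever bundle F (`hL`) and NOTHING ELSE: the regulator input is a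
KERNEL certificate by seat tam3-p2's regime-free split row checker, joined by this seat. Closed BY NAME by `Theorems.Rest3Rungs.stub_rung_shaDiv_TR8_lever` (seat g8).
[cite: Skinner2016PacificMC, Thm. A and Thm. C (§1)] [cite: SteinWuthrich2013, Thm. 6.1 (p. 20), §4.2] [cite: Disegni2020, Thm. 1 (§1.2)]
[cite: JetchevSkinnerWan2017, Thm. 3.3.1, §7.4.1] -/
theorem stub_rung_shaDiv_TR8_lever
    [((⟨1, -1, 0, -1476380199, -21149829976195⟩ : WeierstrassCurve ℤ).baseChange ℚ).IsElliptic]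
    [((⟨1, -1, 0, -1476380199, -21149829976195⟩ : WeierstrassCurve ℤ).baseChange ℚ).IsGloballyMinimal]
    (hF : Summit.BirchSwinnertonDyer.BirchSwinnertonDyer.Theses.ErratumRoadFive.PublishedInputsFive)
    (h331 : Summit.BirchSwinnertonDyer.BirchSwinnertonDyer.Theses.ErratumRoadFive.JSWAnticyclotomicControlMult)
    (hL : Literature.NumberTheory.EllipticCurves.Skinner2016.thmA_charIdeal_multiplicative ∧
      Literature.NumberTheory.EllipticCurves.SteinWuthrich2013.thm61_nonsplitMultiplicative ∧
      Literature.NumberTheory.EllipticCurves.SteinWuthrich2013.thm61_splitMultiplicative ∧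
      Literature.NumberTheory.EllipticCurves.SteinWuthrich2013.exists_isMultCanonical ∧
      Literature.NumberTheory.EllipticCurves.SteinWuthrich2013.exists_isSplitMultCanonical ∧
      Literature.NumberTheory.EllipticCurves.Disegni2020.thm1_padicBSD_rankOne_multiplicative ∧
      Literature.NumberTheory.EllipticCurves.ModularForms.nonempty_modularParametrizationData) :
    Summit.BirchSwinnertonDyer.Rank1Residual.X11b.P2OpenInputOnTreeAt
      ((⟨1, -1, 0, -1476380199, -21149829976195⟩ : WeierstrassCurve ℤ).baseChange ℚ) 5 := by
  sorry

/-- **KF · `stub_rest3_kolyFacts` — CITABLE FACT BUNDLE OF THE KOLYVAGIN ROAD (not a genuine stub; v17)**: Shimura reciprocity for the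
conductor-`1` Heegner point (`heegnerPointOfConductor_one_galoisConj`, the `hrec` binder), McCallum's structure theorem in certificate form
(`McCallum1991_pow_dvd_card_sha_primary_of_certificate`: `p^{2(M₀ − M)} ∣ #Ш(E/K)[p^∞]` from ONE level-`(M+1)` certificate, the `hMc` binder) and
Darmon Thm. 3.6 (`phi_heegnerTau_mem_range_map_singularModuliField`, the `h36` binder, seam G-a) — each a Literature named fact BY NAME (verbatim the
binders of `Theorems.ramNoErratumDataAtFive_of_publishedInputsFive_of_kolyvaginTamFramesHL`; not bound by `ErratumRoadFive`). Used only by line 3.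
[cite: McCallumLMS1991, §5 Cor. 5.6 (p. 310), Lemma 5.1 (p. 303)] [cite: Darmon2004, Thm. 3.6 (PDF pp. 43–44)] [cite: GrossLMS1991, §3 (3.3)–(3.4)] -/
theorem stub_rest3_kolyFacts :
    (∀ (N : ℕ) [NeZero N] (W : WeierstrassCurve ℚ) (K : Type) [Field K] [NumberField K],
        heegnerPointOfConductor_one_galoisConj N W K) ∧
      McCallum1991_pow_dvd_card_sha_primary_of_certificate ∧
      (∀ (N : ℕ) [NeZero N] (W : WeierstrassCurve ℚ) (K : Type) [Field K] [NumberField K],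
        phi_heegnerTau_mem_range_map_singularModuliField N W K) := by
  sorry

/-- **KZT · `stub_rest3_kolyvaginTamFrames` — GENUINE (v17, line 3): W. ZHANG'S TAMAGAWA-REFINED KOLYVAGIN NON-VANISHING AT THE HOFFSTEIN–LUO
FRAMES OF THE REST‴ PAIRS** (VERBATIM the binder `hZt` of `Theorems.ramNoErratumDataAtFive_of_publishedInputsFive_of_kolyvaginTamFramesHL`, seat g2 ∕ nw1):
at every X11b pair `(E, p)` with `p ≥ 5` multiplicative, `ρ̄_{E,p}` onto, a (ram) witness and NO erratum datum, and every Manin-good conductor-`1` frame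
`(Dt, β, ι)` (`4N ∣ β² − d_K`, `p ∤ c`) of every Hoffstein–Luo field `K` (`d_K` odd, Heegner for `N_E`, `L(E^{d_K},1) ≠ 0`, `d_K ≠ −3`): a Kolyvagin certificate
`Koly.CertificateAt Dt β ι p M` of some level `M + 1` with `M ≤ t := ord_p ∏_ℓ c_ℓ(E)` — a square-free product `n` of Kolyvagin primes `ℓ` with
`p^{M+1} ∣ ℓ + 1, a_ℓ` and a derived Heegner point `P_n ∉ p^{M+1} E(K[n])` (McCallum's `M_∞ ≤ t`). TIGHT: modulo McCallum it is EQUIVALENT to STEP L at the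
frame (nw1 `kolyvaginTamCertificate_iff_indexLowerBoundAt`), hence to the crux's content there. STATUS: on the Locus `t = 0` it is Kolyvagin's conjecture mod `p`
(W. Zhang 2014 Thm. 1.1 at good ordinary `p`; [SkinnerZhang2014] Thm. 1.3 at `p ∥ N` on its ♠-locus — UNREFEREED); for `t > 0` the refined statement
`M_∞ = Σ_ℓ ord_p c_ℓ` is [BurungaleCastellaGrossiSkinner2026] Thm. 2 at GOOD ORDINARY `p` only; NO statement at a multiplicative `p` is in print — class-wide
OPEN (Jetchev 2008 Thm. 1.4 gives the opposite inequality `M_∞ ≥ max ord_p c_ℓ` at `p ∤ N`). Per pair it is a finite but heavy computation (derived Heegner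
points over ring class fields `K[ℓ]`; Jetchev–Lauter–Stein 2009 for small conductors); none is attempted for the SD members of record (`N ≥ 10⁹`). With KF and
the two `closes` binders it implies the crux (`RamNoErratumDataAtFive_of_kolyvaginTam_items`). Registered as the honest name of the crux's residual on the
REGULATOR-FREE road. [cite: WZhang2014, Thm. 1.1 (p. 195), Remark 5 and Thm. 10.2 (p. 199)] [cite: SkinnerZhang2014, Thm. 1.3 (arXiv:1407.1099 §1)]
[cite: BurungaleEtAl2026, Thm. 2 (arXiv:2312.09301 §0.1)] [cite: Jetchev2008, Thm. 1.4] [cite: McCallumLMS1991, §5 Cor. 5.6 (p. 310)] -/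
theorem stub_rest3_kolyvaginTamFrames :
    ∀ (W : WeierstrassCurve ℚ) [W.IsElliptic] [W.IsGloballyMinimal] [NeZero (W.conductorNorm ℤ)]
      (p : ℕ) [Fact p.Prime] (K : Type) [Field K] [NumberField K]
      (Dt : Literature.NumberTheory.EllipticCurves.ModularForms.ModularParametrizationData W (W.conductorNorm ℤ)) (β : ℤ) (ι : K →+* ℂ),
      ClassX11b W p → 5 ≤ p → W.HasMultiplicativeReductionAtPrime p → Literature.NumberTheory.EllipticCurves.Rank1Residual.Surj W p →
      Literature.NumberTheory.EllipticCurves.Rank1Residual.Ram W p →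
      ¬ ((∃ (q : ℕ) (_ : Fact q.Prime), q ≠ 2 ∧ q ≠ p ∧ Literature.NumberTheory.EllipticCurves.Rank1Residual.Mult W q ∧
          ¬ W.HasSplitMultiplicativeReductionAtPrime q ∧ ¬ p ∣ padicValInt q W.minimalDiscriminantInt) ∧
        (∀ P : (W.baseChange ℚ_[p]).toAffine.Point, p • P = 0 → P = 0)) →
      IsImaginaryQuadratic K → Odd (NumberField.discr K) →
      SatisfiesHeegnerHypothesis (W.conductorNorm ℤ) K →
      (W.quadraticTwist (NumberField.discr K : ℚ)).entireLFunction 1 ≠ 0 →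
      NumberField.discr K ≠ -3 →
      (4 * (W.conductorNorm ℤ : ℤ)) ∣ β ^ 2 - NumberField.discr K → ¬ (p : ℤ) ∣ Dt.c →
      ∃ M : ℕ, M ≤ padicValNat p W.tamagawaProduct ∧
        Summit.BirchSwinnertonDyer.Rank1Residual.X11b.Three.Koly.CertificateAt Dt β ι p M := by
  sorry

/-! ## Stub statements by name -/

namespace Statement

/-- Statement of `stub_rest3_shaUnit` (v4: a DERIVED theorem — its statement carries the two support binders). -/
abbrev stub_rest3_shaUnit : Prop := type_of% @Birth.stub_rest3_shaUnit
/-- Statement of `stub_rest3_shaDiv`. -/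
abbrev stub_rest3_shaDiv : Prop := type_of% @Birth.stub_rest3_shaDiv
/-- Statement of `stub_rung_rest3_5015b1` (plan-only BC5 rung; not used by `RamNoErratumDataAtFive_of`). -/
abbrev stub_rung_rest3_5015b1 : Prop := type_of% @Birth.stub_rung_rest3_5015b1
/-- Statement of `stub_rung_rest4_5595f1` (plan-only rung; not used by `RamNoErratumDataAtFive_of`). -/
abbrev stub_rung_rest4_5595f1 : Prop := type_of% @Birth.stub_rung_rest4_5595f1
/-- Statement of `stub_rung_shaDiv_D1_visible` (plan-only rung inside SD; not used by `RamNoErratumDataAtFive_of`). -/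
abbrev stub_rung_shaDiv_D1_visible : Prop := type_of% @Birth.stub_rung_shaDiv_D1_visible
/-- Statement of `stub_rung_shaDiv_D1_hesse` (plan-only rung inside SD, v5; not used by `RamNoErratumDataAtFive_of`). -/
abbrev stub_rung_shaDiv_D1_hesse : Prop := type_of% @Birth.stub_rung_shaDiv_D1_hesse
/-- Statement of `stub_rung_shaDiv_D2_hesse` (plan-only rung inside SD, v5; not used by `RamNoErratumDataAtFive_of`). -/
abbrev stub_rung_shaDiv_D2_hesse : Prop := type_of% @Birth.stub_rung_shaDiv_D2_hesse

/-- Statement of `stub_rest3_leverFacts` (citable fact bundle, v7; used by `RamNoErratumDataAtFive_of_regulator` only). -/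
abbrev stub_rest3_leverFacts : Prop := type_of% @Birth.stub_rest3_leverFacts
/-- Statement of `stub_shaDiv_regulatorNonvanishing` (GENUINE, v7 line 2: Schneider on (D)). -/
abbrev stub_shaDiv_regulatorNonvanishing : Prop := type_of% @Birth.stub_shaDiv_regulatorNonvanishing
/-- Statement of `stub_rung_shaDiv_D1_lever` (plan-only rung inside (D) on the lever, v7; not used by the compositions). -/
abbrev stub_rung_shaDiv_D1_lever : Prop := type_of% @Birth.stub_rung_shaDiv_D1_lever
/-- Statement of `stub_rung_shaDiv_D2_lever` (plan-only rung inside (D) on the lever, v7). -/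
abbrev stub_rung_shaDiv_D2_lever : Prop := type_of% @Birth.stub_rung_shaDiv_D2_lever
/-- Statement of `stub_rung_shaDiv_D4_lever` (plan-only rung inside (D) on the lever, v7). -/
abbrev stub_rung_shaDiv_D4_lever : Prop := type_of% @Birth.stub_rung_shaDiv_D4_lever
/-- Statement of `stub_rung_shaDiv_D6_lever` (plan-only rung inside (D) on the lever, v7). -/
abbrev stub_rung_shaDiv_D6_lever : Prop := type_of% @Birth.stub_rung_shaDiv_D6_lever

/-- Statement of `stub_rung_shaDiv_D5_lever` (plan-only rung inside (D) on the lever, v8). -/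
abbrev stub_rung_shaDiv_D5_lever : Prop := type_of% @Birth.stub_rung_shaDiv_D5_lever

/-- Statement of `stub_rung_shaDiv_D3_lever` (plan-only rung inside (D) on the lever, v9). -/
abbrev stub_rung_shaDiv_D3_lever : Prop := type_of% @Birth.stub_rung_shaDiv_D3_lever
/-- Statement of `stub_rung_shaDiv_D0_lever` (plan-only rung inside (D) on the lever, v9). -/
abbrev stub_rung_shaDiv_D0_lever : Prop := type_of% @Birth.stub_rung_shaDiv_D0_lever

/-- Statement of `stub_rung_shaDiv_TR1_lever` (plan-only rung at a TR member on the lever, v10). -/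
abbrev stub_rung_shaDiv_TR1_lever : Prop := type_of% @Birth.stub_rung_shaDiv_TR1_lever
/-- Statement of `stub_rung_shaDiv_TR2_lever` (plan-only rung at a TR member on the lever, v10). -/
abbrev stub_rung_shaDiv_TR2_lever : Prop := type_of% @Birth.stub_rung_shaDiv_TR2_lever

/-- Statement of `stub_rung_shaDiv_TR5_lever` (plan-only rung at a deep TR member on the lever, v12). -/
abbrev stub_rung_shaDiv_TR5_lever : Prop := type_of% @Birth.stub_rung_shaDiv_TR5_lever

/-- Statement of `stub_rung_shaDiv_TR3_lever` (plan-only rung at a deep TR member on the lever, v12). -/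
abbrev stub_rung_shaDiv_TR3_lever : Prop := type_of% @Birth.stub_rung_shaDiv_TR3_lever

/-- Statement of `stub_rung_shaDiv_TR4_lever` (plan-only rung at a deep TR member on the lever, v12). -/
abbrev stub_rung_shaDiv_TR4_lever : Prop := type_of% @Birth.stub_rung_shaDiv_TR4_lever

/-- Statement of `stub_rung_shaDiv_TR6_lever` (plan-only rung at a deep TR member on the lever, v12). -/
abbrev stub_rung_shaDiv_TR6_lever : Prop := type_of% @Birth.stub_rung_shaDiv_TR6_lever

/-- Statement of `stub_rung_shaDiv_TR10_lever` (plan-only rung at a deep TR member on the lever, v12). -/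
abbrev stub_rung_shaDiv_TR10_lever : Prop := type_of% @Birth.stub_rung_shaDiv_TR10_lever

/-- Statement of `stub_rung_shaDiv_TR9_lever` (plan-only rung at a deep TR member on the lever, v13). -/
abbrev stub_rung_shaDiv_TR9_lever : Prop := type_of% @Birth.stub_rung_shaDiv_TR9_lever

/-- Statement of `stub_rung_shaDiv_TR7_lever` (plan-only rung at a deep TR member on the lever, v14). -/
abbrev stub_rung_shaDiv_TR7_lever : Prop := type_of% @Birth.stub_rung_shaDiv_TR7_lever

/-- Statement of `stub_rung_shaDiv_TR8_lever` (plan-only rung at a deep TR member on the lever, v14). -/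
abbrev stub_rung_shaDiv_TR8_lever : Prop := type_of% @Birth.stub_rung_shaDiv_TR8_lever
/-- Statement of `stub_rest3_kolyFacts` (citable bundle KF of line 3, v17). -/
abbrev stub_rest3_kolyFacts : Prop := type_of% @Birth.stub_rest3_kolyFacts
/-- Statement of `stub_rest3_kolyvaginTamFrames` (genuine stub KZT of line 3, v17). -/
abbrev stub_rest3_kolyvaginTamFrames : Prop := type_of% @Birth.stub_rest3_kolyvaginTamFrames

end Statement

/-! ## The composition (sorry-free): the support binders + the SD stub STATEMENT imply the crux, BY NAME -/

/-- **`RamNoErratumDataAtFive_of`** — REST‴ from the route's support items `PublishedInputsFive` (`hPub`, item 19066) and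
`JSWAnticyclotomicControlMult` (`hJSW`, item 19626), which give the Ш_an-unit part SU (`stub_rest3_shaUnit`, derived), and the
Ш_an-divisible part SD (`stub_rest3_shaDiv`, the one open branch stub): the lossless glue `Theorems.rest3_of_shaBranches` (case
split on the datum `∃ s, #Ш(E)_an = s ∧ ord_p s ≤ 0`). Pure logic. (v4 = RULING 16 A1: binders as 19109's `_of` takes
`PublishedInputsThree`.) -/
theorem RamNoErratumDataAtFive_of
    (hPub : Summit.BirchSwinnertonDyer.BirchSwinnertonDyer.Theses.ErratumRoadFive.PublishedInputsFive)
    (hJSW : Summit.BirchSwinnertonDyer.BirchSwinnertonDyer.Theses.ErratumRoadFive.JSWAnticyclotomicControlMult)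
    (hD : Statement.stub_rest3_shaDiv) :
    Summit.BirchSwinnertonDyer.BirchSwinnertonDyer.Theses.ErratumRoadFive.RamNoErratumDataAtFive :=
  Summit.BirchSwinnertonDyer.BirchSwinnertonDyer.Theorems.rest3_of_shaBranches (stub_rest3_shaUnit hPub hJSW) hD

/-- The crux along this line from the two support binders, MODULO exactly the one registered branch stub SD (sorries live only
in `stub_*`). -/
theorem RamNoErratumDataAtFive_proof
    (hPub : Summit.BirchSwinnertonDyer.BirchSwinnertonDyer.Theses.ErratumRoadFive.PublishedInputsFive)
    (hJSW : Summit.BirchSwinnertonDyer.BirchSwinnertonDyer.Theses.ErratumRoadFive.JSWAnticyclotomicControlMult) :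
    Summit.BirchSwinnertonDyer.BirchSwinnertonDyer.Theses.ErratumRoadFive.RamNoErratumDataAtFive :=
  RamNoErratumDataAtFive_of hPub hJSW stub_rest3_shaDiv

/-! ## The alternative composition along the LEVER (v7, sorry-free): hPub + hJSW + F + SCH imply the crux, BY NAME -/

/-- **SD from F + SCH + the two support binders** (seat g7's `Theorems.rest3ShaDivisibleBranchAtFive_of_items_of_leverFacts_of_regulatorOnD`,
re-proved here from the stub STATEMENTS so that the skeleton is self-contained): at a sharp (D)-pair the lever
(`ClassClosure.bsdp_of_leverLocus_of_regulatorNonvanishing`; locus = the (ram) prime at `p ≥ 5`) gives `BSD(E,p)` from SCH, and one-sided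
tightness with the JSW control identity (`P2.openInputOnTreeAt_of_bsdp_of_ram`, `p2ControlOnTreeAt_of_thm331Mult`) gives the open input.
Pure composition. [cite: Skinner2016PacificMC, Thm. A and Thm. C (§1)] [cite: SteinWuthrich2013, Thm. 6.1, §4.2] [cite: Disegni2020, Thm. 1 (§1.2)] -/
theorem shaDiv_of_leverFacts_of_regulator
    (hPub : Summit.BirchSwinnertonDyer.BirchSwinnertonDyer.Theses.ErratumRoadFive.PublishedInputsFive)
    (hJSW : Summit.BirchSwinnertonDyer.BirchSwinnertonDyer.Theses.ErratumRoadFive.JSWAnticyclotomicControlMult)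
    (hL : Statement.stub_rest3_leverFacts) (hR : Statement.stub_shaDiv_regulatorNonvanishing) :
    Statement.stub_rest3_shaDiv := by
  obtain ⟨hGZ, hKo, -, hSk, -, hGZK, hmod, -, -, -, -, -, -, -, -⟩ := hPub
  obtain ⟨hSkA, hJn, hJs, hHn, hHs, hD, hpar⟩ := hL
  refine Summit.BirchSwinnertonDyer.BirchSwinnertonDyer.Theorems.rest3ShaDivisibleBranchAtFive_of_sharp
    fun W _ _ p _ hX hp5 _ hram hno hpos ↦ ?_
  exact P2.openInputOnTreeAt_of_bsdp_of_ram W p hGZ hKo hSk hGZK hmod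
    (Summit.BirchSwinnertonDyer.BirchSwinnertonDyer.Theorems.p2ControlOnTreeAt_of_thm331Mult W p hJSW hKo) hram
    (ClassClosure.bsdp_of_leverLocus_of_regulatorNonvanishing W p hSkA hJn hJs hHn hHs hD hGZK hpar hX
      (ClassClosure.leverLocusAt_of_ram_of_five_le W p hram hp5) (hR W p hX hp5 hram hno hpos))

/-- **`RamNoErratumDataAtFive_of_regulator`** — the crux BY NAME along line 2: the support binders give SU (`stub_rest3_shaUnit`, derived)
and, with F + SCH, SD (`shaDiv_of_leverFacts_of_regulator`); glue `Theorems.rest3_of_shaBranches`. Pure logic; sorries only in `stub_*`.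
[cite: Castella2018Erratum, Thm. 1.1 (iii)–(iv)] [cite: JetchevSkinnerWan2017, Thm. 3.3.1] -/
theorem RamNoErratumDataAtFive_of_regulator
    (hPub : Summit.BirchSwinnertonDyer.BirchSwinnertonDyer.Theses.ErratumRoadFive.PublishedInputsFive)
    (hJSW : Summit.BirchSwinnertonDyer.BirchSwinnertonDyer.Theses.ErratumRoadFive.JSWAnticyclotomicControlMult)
    (hL : Statement.stub_rest3_leverFacts) (hR : Statement.stub_shaDiv_regulatorNonvanishing) :
    Summit.BirchSwinnertonDyer.BirchSwinnertonDyer.Theses.ErratumRoadFive.RamNoErratumDataAtFive :=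
  RamNoErratumDataAtFive_of hPub hJSW (shaDiv_of_leverFacts_of_regulator hPub hJSW hL hR)

/-- The crux along line 2 from the two support binders, MODULO exactly F (citable) and SCH (sorries live only in `stub_*`). -/
theorem RamNoErratumDataAtFive_proof_regulator
    (hPub : Summit.BirchSwinnertonDyer.BirchSwinnertonDyer.Theses.ErratumRoadFive.PublishedInputsFive)
    (hJSW : Summit.BirchSwinnertonDyer.BirchSwinnertonDyer.Theses.ErratumRoadFive.JSWAnticyclotomicControlMult) :
    Summit.BirchSwinnertonDyer.BirchSwinnertonDyer.Theses.ErratumRoadFive.RamNoErratumDataAtFive :=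
  RamNoErratumDataAtFive_of_regulator hPub hJSW stub_rest3_leverFacts stub_shaDiv_regulatorNonvanishing


/-! ## The compositions re-keyed to `closes` rev 42 (v15, sorry-free): hPub (19066) + hRed (19283) in place of hJSW (19626, aside) -/

/-- **`RamNoErratumDataAtFive_of_items`** — as `RamNoErratumDataAtFive_of`, with the JSW control input DERIVED from the support item
`PublishedInputsIMCReduction` (19283, a `closes` binder after DROP-JSW) by `Theorems.jswAnticyclotomicControlMult_of_publishedInputsIMCReduction`
(imc-p1 g16, p596606). Pure logic. [cite: JetchevSkinnerWan2017, Thm. 3.3.1] -/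
theorem RamNoErratumDataAtFive_of_items
    (hPub : Summit.BirchSwinnertonDyer.BirchSwinnertonDyer.Theses.ErratumRoadFive.PublishedInputsFive)
    (hRed : Summit.BirchSwinnertonDyer.BirchSwinnertonDyer.Theses.ErratumRoadFive.PublishedInputsIMCReduction)
    (hD : Statement.stub_rest3_shaDiv) :
    Summit.BirchSwinnertonDyer.BirchSwinnertonDyer.Theses.ErratumRoadFive.RamNoErratumDataAtFive :=
  RamNoErratumDataAtFive_of hPub
    (Summit.BirchSwinnertonDyer.BirchSwinnertonDyer.Theorems.jswAnticyclotomicControlMult_of_publishedInputsIMCReduction hRed) hD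

/-- The crux along line 1 from the two `closes` binders hPub, hRed, MODULO exactly SD (sorries live only in `stub_*`). -/
theorem RamNoErratumDataAtFive_proof_items
    (hPub : Summit.BirchSwinnertonDyer.BirchSwinnertonDyer.Theses.ErratumRoadFive.PublishedInputsFive)
    (hRed : Summit.BirchSwinnertonDyer.BirchSwinnertonDyer.Theses.ErratumRoadFive.PublishedInputsIMCReduction) :
    Summit.BirchSwinnertonDyer.BirchSwinnertonDyer.Theses.ErratumRoadFive.RamNoErratumDataAtFive :=
  RamNoErratumDataAtFive_of_items hPub hRed stub_rest3_shaDiv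

/-- **`RamNoErratumDataAtFive_of_regulator_items`** — the crux BY NAME along line 2 (the lever) from the `closes` binders hPub, hRed + F + SCH.
Pure logic; sorries only in `stub_*`. [cite: Skinner2016PacificMC, Thm. A and Thm. C (§1)] [cite: JetchevSkinnerWan2017, Thm. 3.3.1] -/
theorem RamNoErratumDataAtFive_of_regulator_items
    (hPub : Summit.BirchSwinnertonDyer.BirchSwinnertonDyer.Theses.ErratumRoadFive.PublishedInputsFive)
    (hRed : Summit.BirchSwinnertonDyer.BirchSwinnertonDyer.Theses.ErratumRoadFive.PublishedInputsIMCReduction)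
    (hL : Statement.stub_rest3_leverFacts) (hR : Statement.stub_shaDiv_regulatorNonvanishing) :
    Summit.BirchSwinnertonDyer.BirchSwinnertonDyer.Theses.ErratumRoadFive.RamNoErratumDataAtFive :=
  RamNoErratumDataAtFive_of_regulator hPub
    (Summit.BirchSwinnertonDyer.BirchSwinnertonDyer.Theorems.jswAnticyclotomicControlMult_of_publishedInputsIMCReduction hRed) hL hR

/-- The crux along line 2 from the two `closes` binders, MODULO exactly F (citable) and SCH. -/
theorem RamNoErratumDataAtFive_proof_regulator_items
    (hPub : Summit.BirchSwinnertonDyer.BirchSwinnertonDyer.Theses.ErratumRoadFive.PublishedInputsFive)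
    (hRed : Summit.BirchSwinnertonDyer.BirchSwinnertonDyer.Theses.ErratumRoadFive.PublishedInputsIMCReduction) :
    Summit.BirchSwinnertonDyer.BirchSwinnertonDyer.Theses.ErratumRoadFive.RamNoErratumDataAtFive :=
  RamNoErratumDataAtFive_of_regulator_items hPub hRed stub_rest3_leverFacts stub_shaDiv_regulatorNonvanishing

/-! ## The third composition, along the TAMAGAWA-REFINED KOLYVAGIN ROAD (v17, sorry-free): hPub (19066) + hRed (19283) + KF + KZT imply the crux, BY NAME -/

/-- **`RamNoErratumDataAtFive_of_kolyvaginTam_items`** — the crux BY NAME along line 3: the `closes` binders `PublishedInputsFive` (`hPub`) and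
`PublishedInputsIMCReduction` (`hRed`, giving the JSW control by `Theorems.jswAnticyclotomicControlMult_of_publishedInputsIMCReduction`), the citable bundle
KF (`hKF`) and the Tamagawa-refined Kolyvagin frames KZT (`hZt`) — literally `Theorems.ramNoErratumDataAtFive_of_publishedInputsFive_of_kolyvaginTamFramesHL`
(seat g2 on nw1's pair-level kernel). Pure composition; sorries only in `stub_*`. [cite: McCallumLMS1991, §5 Cor. 5.6 (p. 310)] [cite: WZhang2014, Thm. 1.1 and Remark 5]
[cite: JetchevSkinnerWan2017, Thm. 3.3.1] -/
theorem RamNoErratumDataAtFive_of_kolyvaginTam_items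
    (hPub : Summit.BirchSwinnertonDyer.BirchSwinnertonDyer.Theses.ErratumRoadFive.PublishedInputsFive)
    (hRed : Summit.BirchSwinnertonDyer.BirchSwinnertonDyer.Theses.ErratumRoadFive.PublishedInputsIMCReduction)
    (hKF : Statement.stub_rest3_kolyFacts) (hZt : Statement.stub_rest3_kolyvaginTamFrames) :
    Summit.BirchSwinnertonDyer.BirchSwinnertonDyer.Theses.ErratumRoadFive.RamNoErratumDataAtFive :=
  Summit.BirchSwinnertonDyer.BirchSwinnertonDyer.Theorems.ramNoErratumDataAtFive_of_publishedInputsFive_of_kolyvaginTamFramesHL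
    hPub (Summit.BirchSwinnertonDyer.BirchSwinnertonDyer.Theorems.jswAnticyclotomicControlMult_of_publishedInputsIMCReduction hRed)
    hKF.1 hKF.2.1 hKF.2.2 hZt

/-- The crux along line 3 from the two `closes` binders, MODULO exactly KF (citable) and KZT (sorries live only in `stub_*`). -/
theorem RamNoErratumDataAtFive_proof_kolyvaginTam_items
    (hPub : Summit.BirchSwinnertonDyer.BirchSwinnertonDyer.Theses.ErratumRoadFive.PublishedInputsFive)
    (hRed : Summit.BirchSwinnertonDyer.BirchSwinnertonDyer.Theses.ErratumRoadFive.PublishedInputsIMCReduction) :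
    Summit.BirchSwinnertonDyer.BirchSwinnertonDyer.Theses.ErratumRoadFive.RamNoErratumDataAtFive :=
  RamNoErratumDataAtFive_of_kolyvaginTam_items hPub hRed stub_rest3_kolyFacts stub_rest3_kolyvaginTamFrames

end Summit.BirchSwinnertonDyer.BirchSwinnertonDyer.Cruxes.RamNoErratumDataAtFive.Birth

end
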